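import Literature.NumberTheory.LFunctions.BondarenkoHeap2026Section6Weights
import Literature.NumberTheory.LFunctions.BondarenkoHeap2026OffDiagPartition
import Literature.NumberTheory.LFunctions.BondarenkoHeap2026OffDiagKernels
import Literature.NumberTheory.LFunctions.BondarenkoHeap2026Sections3to5Proofs
import Literature.NumberTheory.LFunctions.MellinSeparatedWeights
import Literature.NumberTheory.LFunctions.SmoothDyadicPartition
import Mathlib.MeasureTheory.Integral.DominatedConvergence
import HarnessLib

/-!
# Bondarenko–Heap 2026, §6.2: assembly of the reduction `offDiag_reduction'` (layer L3b)

LABEL (C5 / rh-crit-ah, LADDER-RH §4 HELD «conditional bridges: exceptional zero ⇒ …»):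
**NOT RH-BEARING.** Kernel bookkeeping of finite sums and compact integrals inside §6.2 of the
unrefereed preprint arXiv:2608.07399v1 ("We now separate variables in `𝓕` via an inverse Mellin
transform", TeX l.799); nothing here bears on the truth of RH.

This file is the ASSEMBLY layer (L3b of the cell programme `ah/MEMO-t3-offDiagReduction.md`, re-cut
R-g5-35/37): it turns

* a box decomposition of `𝒪𝒟` into smooth dyadic pieces (layer L3a, sibling
  `BondarenkoHeap2026OffDiagPartition`),
* the two one-variable profiles `V_N` (the `n`-profile `G(n) n^{−1/2}` localised at scale `N`) and
  `W_{U,t}` (the `u = r/(km)`-kernel `Ŵ_T(log(1+su)/2π)(1+su)^{−it}/T` localised at scale `U`) with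
  the uniform decay of their Mellin transforms on the line `Re s = 0` (sibling
  `BondarenkoHeap2026OffDiagKernels`), and
* the separated weights `α, β, γ` (bump² times a unimodular power) in the corrected class
  `IsSmoothDyadicWeight'` (same sibling, and `MellinSeparatedWeights`),

into the printed conclusion "From this it will follow, after integrating, and then summing the
`≪ (log T)^{O(1)}` partitions, that `𝒪𝒟 ≪ q^ε T/q^η`" (TeX l.838–841), i.e. the named fact
`offDiag_reduction'` of `BondarenkoHeap2026Section6Weights`. The printed triple inverse Mellin
transform (TeX l.799–825) is realised as two NESTED one-variable truncated inversions (the factor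
`(1+su)^{−it}` produced by the `n`-inversion is explicit and joins the `u`-kernel, so no
multi-variable Mellin analysis is needed — a route of ours, recorded as such; the printed
three-variable transform `𝓕̃₀(s₁,s₂,s₃)` is not formalised); the step "pushing the sum through the
integral" (TeX l.827) is `sum_intervalIntegral₂_eq`; the sentence "Strictly speaking, the `q^ε` out
front should be a normalisation factor `‖a,b,c‖_∞`" (TeX l.831) corresponds here to the explicit
product of the two Mellin sup-norms, the normalisers `c_A, c_B` and `(2H)²`; and the truncation
errors ("This gives a negligible error `O(T^{-C})` by the rapid decay", TeX l.825) are summed with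
the trivial bound `Λ(k) ≤ log k`.

This revision (v1, the ABSTRACT layers; the inputs of the sibling files enter as hypotheses of the
stated shapes, so that nothing here depends on their names): Part A — kernel algebra for the
unimodular powers `x^{−it}`, bounds for double interval integrals, the finite-sum/double-integral
exchange, the emergence of `corrSumE` from separated weights given by evaluation identities; Part B
— the nested truncated expansion of one summand and its error, abstractly; Parts C–E — the
factorisation of one smoothed summand of `𝒪𝒟`, the insertion of the `n`- and `u`-partitions, the
error of one piece; Part D — exchange and emergence of `E(K,M,R)`; Part F — `box_bound`, the
complete estimate for ONE box and one sign from abstract profile/weight data. The instantiation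
(sum over the boxes of `offDiagOD_eq_sum_boxes`, choice of `H = q^{ε₂}` and of the truncation order,
count of boxes) follows in v2.

## References

* [BondarenkoHeap2026] A. Bondarenko, W. Heap, arXiv:2608.07399v1, §6.2 (authors' TeX of record,
  l.742–845; the quoted sentences are at l.751, l.825, l.827, l.831, l.838–841).
* [Titchmarsh1948] E. C. Titchmarsh, *Introduction to the Theory of Fourier Integrals*, §1.29.
-/

noncomputable section

open Real Complex MeasureTheory Set Filter Finset intervalIntegral
open scoped ContDiff ArithmeticFunction.vonMangoldt

namespace Literature.NumberTheory.LFunctions.BondarenkoHeap2026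

namespace OffDiagAssembly

/-! ### A.1 Kernel algebra: the unimodular powers `x ↦ x^{−it}` -/

/-- For a positive real base the power `x^{−it}` is unimodular. [folklore] -/
private theorem norm_ofReal_cpow_neg_mul_I {x : ℝ} (hx : 0 < x) (t : ℝ) :
    ‖((x : ℝ) : ℂ) ^ (-(t * I))‖ = 1 := by
  rw [Complex.norm_cpow_eq_rpow_re_of_pos hx]
  simp

/-- `(ab)^z = a^z b^z` for positive reals `a, b`. [folklore] -/
private theorem ofReal_mul_cpow {a b : ℝ} (ha : 0 ≤ a) (hb : 0 ≤ b) (z : ℂ) :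
    (((a * b : ℝ)) : ℂ) ^ z = ((a : ℝ) : ℂ) ^ z * ((b : ℝ) : ℂ) ^ z := by
  push_cast
  exact Complex.mul_cpow_ofReal_nonneg ha hb z

/-- `(a⁻¹)^z = a^{−z}` for a positive real `a`. [folklore] -/
private theorem ofReal_inv_cpow {a : ℝ} (ha : 0 < a) (z : ℂ) :
    (((a⁻¹ : ℝ)) : ℂ) ^ z = ((a : ℝ) : ℂ) ^ (-z) := by
  rw [Complex.ofReal_inv, Complex.inv_cpow _ _ ?_, Complex.cpow_neg]
  rw [Complex.arg_ofReal_of_nonneg ha.le]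
  exact Real.pi_pos.ne

/-- `(a/b)^z = a^z · b^{−z}` for positive reals. [folklore] -/
private theorem ofReal_div_cpow {a b : ℝ} (ha : 0 ≤ a) (hb : 0 < b) (z : ℂ) :
    (((a / b : ℝ)) : ℂ) ^ z = ((a : ℝ) : ℂ) ^ z * ((b : ℝ) : ℂ) ^ (-z) := by
  rw [div_eq_mul_inv, ofReal_mul_cpow ha (inv_nonneg.mpr hb.le), ofReal_inv_cpow hb]

/-- `a^{−z} · a^{z} = 1` for a positive real `a`. [folklore] -/
private theorem ofReal_cpow_neg_mul_cpow {a : ℝ} (ha : 0 < a) (z : ℂ) :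
    ((a : ℝ) : ℂ) ^ (-z) * ((a : ℝ) : ℂ) ^ z = 1 := by
  rw [← Complex.cpow_add _ _ (Complex.ofReal_ne_zero.mpr ha.ne'), neg_add_cancel, Complex.cpow_zero]


/-! ### A.2 Double interval integrals: a bound and the exchange with finite sums -/

/-- **Bound for a double interval integral over `[−H,H]²`**: if `‖F t t'‖ ≤ C` on the square then
`‖∫_{−H}^{H}∫_{−H}^{H} F‖ ≤ (2H)² C` (our rendering of the step "after integrating", TeX l.838, over
the truncated square `|t|, |t'| ≤ H`). [cite: BondarenkoHeap2026, §6.2, TeX l.825 and l.838] -/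
theorem norm_intervalIntegral₂_le {F : ℝ → ℝ → ℂ} {H C : ℝ} (hH : 0 ≤ H)
    (hF : ∀ t ∈ Set.Icc (-H) H, ∀ t' ∈ Set.Icc (-H) H, ‖F t t'‖ ≤ C) :
    ‖∫ t in -H..H, ∫ t' in -H..H, F t t'‖ ≤ (2 * H) ^ 2 * C := by
  have hI : Set.uIoc (-H) H ⊆ Set.Icc (-H) H := by
    rw [Set.uIoc_of_le (by linarith)]; exact Set.Ioc_subset_Icc_self
  have hinner : ∀ t ∈ Set.uIoc (-H) H, ‖∫ t' in -H..H, F t t'‖ ≤ C * (2 * H) := by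
    intro t ht
    have h := intervalIntegral.norm_integral_le_of_norm_le_const (a := -H) (b := H) (C := C)
      (f := fun t' => F t t') fun t' ht' => hF t (hI ht) t' (hI ht')
    have habs : |H - -H| = 2 * H := by rw [sub_neg_eq_add, abs_of_nonneg (by linarith)]; ring
    rwa [habs] at h
  have h := intervalIntegral.norm_integral_le_of_norm_le_const (a := -H) (b := H)
    (f := fun t => ∫ t' in -H..H, F t t') hinner
  have habs : |H - -H| = 2 * H := by rw [sub_neg_eq_add, abs_of_nonneg (by linarith)]; ring
  rw [habs] at h
  calc ‖∫ t in -H..H, ∫ t' in -H..H, F t t'‖ ≤ C * (2 * H) * (2 * H) := h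
    _ = (2 * H) ^ 2 * C := by ring

/-- **"pushing the sum through the integral"** (TeX l.827): a finite sum of double interval
integrals of jointly continuous functions is the double integral of the sum.
[cite: BondarenkoHeap2026, §6.2, TeX l.827] -/
theorem sum_intervalIntegral₂_eq {ι : Type*} (S : Finset ι) {F : ι → ℝ → ℝ → ℂ}
    (hF : ∀ i ∈ S, Continuous (Function.uncurry (F i))) (a b : ℝ) :
    ∑ i ∈ S, ∫ t in a..b, ∫ t' in a..b, F i t t' = ∫ t in a..b, ∫ t' in a..b, ∑ i ∈ S, F i t t' := by
  have hinner : ∀ i ∈ S, Continuous fun t => ∫ t' in a..b, F i t t' := fun i hi =>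
    intervalIntegral.continuous_parametric_intervalIntegral_of_continuous' (hF i hi) a b
  rw [← intervalIntegral.integral_finsetSum fun i hi => ((hinner i hi).intervalIntegrable _ _)]
  refine intervalIntegral.integral_congr fun t _ => ?_
  rw [← intervalIntegral.integral_finsetSum fun i hi => ?_]
  exact ((hF i hi).comp (Continuous.prodMk_right t)).intervalIntegrable _ _

/-! ### A.3 The correlation sum from separated weights ("relabelling `a_k,b_m` and renormalising
coefficients", TeX l.827) -/

/-- **Emergence of `E(K,M,R)`**: if three weights `α, β, γ` satisfy, at the positive integers, the
evaluation identities `A k · (k/K)^{−z₁} = cA · α k`, `Bm m · (m/M)^{−z₂} = cB · β m`,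
`Cr r · (r/R)^{−z₃} = γ r`, then the triple sum
`Σ_{k,m,r} Λ(k) χ(m) χ(km+sr) · A k (k/K)^{−z₁} · Bm m (m/M)^{−z₂} · Cr r (r/R)^{−z₃}` over the boxes
`Icc 1 ⌊2K⌋ × Icc 1 ⌊2M⌋ × Icc 1 ⌊2R⌋` equals `cA · cB · corrSumE χ s K M R α β γ`.
[cite: BondarenkoHeap2026, §6.2, TeX l.827–835] -/
theorem sum_eq_mul_corrSumE {q : ℕ} (χ : DirichletCharacter ℂ q) (s : ℤ) (K M R : ℝ)
    (A Bm Cr : ℕ → ℂ) (α β γ : ℝ → ℂ) (z₁ z₂ z₃ cA cB : ℂ)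
    (hα : ∀ k : ℕ, 1 ≤ k → A k * ((((k : ℝ) / K : ℝ)) : ℂ) ^ (-z₁) = cA * α k)
    (hβ : ∀ m : ℕ, 1 ≤ m → Bm m * ((((m : ℝ) / M : ℝ)) : ℂ) ^ (-z₂) = cB * β m)
    (hγ : ∀ r : ℕ, 1 ≤ r → Cr r * ((((r : ℝ) / R : ℝ)) : ℂ) ^ (-z₃) = γ r) :
    ∑ k ∈ Icc 1 ⌊2 * K⌋₊, ∑ m ∈ Icc 1 ⌊2 * M⌋₊, ∑ r ∈ Icc 1 ⌊2 * R⌋₊,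
      ((Λ k : ℝ) : ℂ) * (χ (m : ZMod q) * χ (((k : ℤ) * m + s * r : ℤ) : ZMod q)) *
        (A k * ((((k : ℝ) / K : ℝ)) : ℂ) ^ (-z₁)) * (Bm m * ((((m : ℝ) / M : ℝ)) : ℂ) ^ (-z₂)) *
          (Cr r * ((((r : ℝ) / R : ℝ)) : ℂ) ^ (-z₃)) =
      cA * cB * corrSumE χ s K M R α β γ := by
  rw [corrSumE, Finset.mul_sum]
  refine Finset.sum_congr rfl fun k hk => ?_
  have hk1 : 1 ≤ k := (Finset.mem_Icc.mp hk).1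
  rw [Finset.mul_sum, Finset.mul_sum]
  refine Finset.sum_congr rfl fun m hm => ?_
  have hm1 : 1 ≤ m := (Finset.mem_Icc.mp hm).1
  rw [Finset.mul_sum, Finset.mul_sum]
  refine Finset.sum_congr rfl fun r hr => ?_
  have hr1 : 1 ≤ r := (Finset.mem_Icc.mp hr).1
  rw [hα k hk1, hβ m hm1, hγ r hr1]
  ring


/-! ### B. One term, one piece: the nested truncated expansion and its error
("We then truncate the `s_j` integrals at height `q^ε`. This gives a negligible error `O(T^{-C})` by
the rapid decay", TeX l.825) -/

/-- **Nested truncated expansion of one summand, abstract form.** Data: a prefactor `P`, a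
normalisation `Nh ≥ 0`, a profile value `V Y` with truncated expansion
`(1/2π)∫_{−H}^{H} MV(t) Y^{−it} dt` up to `τA`, a factor `Wb` (the `Ŵ_T ω²` factor), the pointwise
separation identity `Y^{−it} Wb = kern₁(t) · T · W(t, v)` with a kernel `‖kern₁‖ ≤ 1`, and for
every `|t| ≤ H` a truncated expansion of `W(t,v)` as `(1/2π)∫_{−H}^{H} MW(t,t') v^{−it'} dt'` up to
`τB`. Then `P · Nh · V(Y) · Wb` differs from the double integral
`P · Nh · T (1/2π)² ∫∫ MV(t) MW(t,t') kern₁(t) v^{−it'}` by at most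
`‖P‖ Nh (τA ‖Wb‖ + (1/2π)(2H) D_V T τB)`. [cite: BondarenkoHeap2026, §6.2, TeX l.825–827] -/
theorem piece_expansion_bound {P Wb : ℂ} {Nh T Y v H τA τB DV : ℝ} (hNh : 0 ≤ Nh) (hT : 0 < T)
    (hY : 0 < Y) (hv : 0 < v) (hH : 0 < H) (hDV : 0 ≤ DV)
    {V : ℝ → ℂ} {MV : ℝ → ℂ} {W : ℝ → ℝ → ℂ} {MW : ℝ → ℝ → ℂ} {kern₁ : ℝ → ℂ}
    (hkc : Continuous kern₁) (hkb : ∀ t, ‖kern₁ t‖ ≤ 1) (hWc : Continuous fun t => W t v)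
    (hWid : ∀ t : ℝ, ((Y : ℝ) : ℂ) ^ (-(t * I)) * Wb = kern₁ t * T * W t v)
    (hVexp : ‖V Y - (1 / (2 * π)) • ∫ t in -H..H, MV t * ((Y : ℝ) : ℂ) ^ (-(t * I))‖ ≤ τA)
    (hMVc : Continuous MV) (hMVb : ∀ t, ‖MV t‖ ≤ DV)
    (hWexp : ∀ t ∈ Set.Icc (-H) H,
      ‖W t v - (1 / (2 * π)) • ∫ t' in -H..H, MW t t' * ((v : ℝ) : ℂ) ^ (-(t' * I))‖ ≤ τB)
    (hMWc : Continuous (Function.uncurry MW)) :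
    ‖P * Nh * V Y * Wb -
        P * ((Nh : ℂ) * (T : ℂ) * (1 / (2 * (π : ℂ))) ^ 2) *
          ∫ t in -H..H, ∫ t' in -H..H, MV t * MW t t' * (kern₁ t * ((v : ℝ) : ℂ) ^ (-(t' * I)))‖ ≤
      ‖P‖ * Nh * (τA * ‖Wb‖ + 1 / (2 * π) * (2 * H) * DV * T * τB) := by
  have hvk : Continuous fun t' : ℝ => ((v : ℝ) : ℂ) ^ (-(t' * I)) :=
    Continuous.const_cpow (by fun_prop) (Or.inl (by exact_mod_cast hv.ne'))
  have hYk : Continuous fun t : ℝ => ((Y : ℝ) : ℂ) ^ (-(t * I)) :=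
    Continuous.const_cpow (by fun_prop) (Or.inl (by exact_mod_cast hY.ne'))
  -- the truncated `W`-expansion as a function of the outer variable
  set TrW : ℝ → ℂ := fun t => (1 / (2 * π)) • ∫ t' in -H..H, MW t t' * ((v : ℝ) : ℂ) ^ (-(t' * I))
    with hTrW
  have hMWv : Continuous (Function.uncurry fun t t' => MW t t' * ((v : ℝ) : ℂ) ^ (-(t' * I))) :=
    hMWc.mul (hvk.comp continuous_snd)
  have hTrWc : Continuous TrW := by
    have h := intervalIntegral.continuous_parametric_intervalIntegral_of_continuous'
      (μ := volume) hMWv (-H) H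
    exact h.const_smul (1 / (2 * π))
  set Tr : ℂ := (1 / (2 * π)) • ∫ t in -H..H, MV t * ((Y : ℝ) : ℂ) ^ (-(t * I)) with hTr
  -- Step a: replace `V Y` by its truncated expansion
  have hNh' : ‖(Nh : ℂ)‖ = Nh := by rw [Complex.norm_real, Real.norm_eq_abs, abs_of_nonneg hNh]
  have ha : ‖P * Nh * V Y * Wb - P * Nh * Tr * Wb‖ ≤ ‖P‖ * Nh * (τA * ‖Wb‖) := by
    have : P * Nh * V Y * Wb - P * Nh * Tr * Wb = P * Nh * ((V Y - Tr) * Wb) := by ring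
    rw [this, norm_mul, norm_mul, norm_mul, hNh']
    gcongr
  -- Step b: `Tr * Wb` as a single integral in which `W` appears
  have hb : Tr * Wb = (1 / (2 * π)) • ∫ t in -H..H, MV t * (kern₁ t * T * W t v) := by
    rw [hTr, smul_mul_assoc, ← intervalIntegral.integral_mul_const]
    congr 1
    refine intervalIntegral.integral_congr fun t _ => ?_
    show MV t * ((Y : ℝ) : ℂ) ^ (-(t * I)) * Wb = MV t * (kern₁ t * T * W t v)
    rw [mul_assoc, hWid t]
  -- Step c: the double integral as a single integral in which `TrW` appears
  have hc : (T : ℂ) * (1 / (2 * π)) ^ 2 *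
      (∫ t in -H..H, ∫ t' in -H..H, MV t * MW t t' * (kern₁ t * ((v : ℝ) : ℂ) ^ (-(t' * I)))) =
      (1 / (2 * π)) • ∫ t in -H..H, MV t * (kern₁ t * T * TrW t) := by
    rw [Complex.real_smul]
    have hin : ∀ t : ℝ, (∫ t' in -H..H, MV t * MW t t' * (kern₁ t * ((v : ℝ) : ℂ) ^ (-(t' * I)))) =
        MV t * kern₁ t * ∫ t' in -H..H, MW t t' * ((v : ℝ) : ℂ) ^ (-(t' * I)) := by
      intro t
      rw [← intervalIntegral.integral_const_mul]
      refine intervalIntegral.integral_congr fun t' _ => ?_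
      show MV t * MW t t' * (kern₁ t * ((v : ℝ) : ℂ) ^ (-(t' * I))) =
        MV t * kern₁ t * (MW t t' * ((v : ℝ) : ℂ) ^ (-(t' * I)))
      ring
    simp_rw [hin]
    rw [← intervalIntegral.integral_const_mul, ← intervalIntegral.integral_const_mul]
    refine intervalIntegral.integral_congr fun t _ => ?_
    simp only [hTrW, Complex.real_smul]
    push_cast
    ring
  -- Step d: the difference of b and c is an integral of `MV · kern₁ · T · (W − TrW)`
  have hint1 : IntervalIntegrable (fun t => MV t * (kern₁ t * T * W t v)) volume (-H) H :=
    ((hMVc.mul ((hkc.mul continuous_const).mul hWc)).intervalIntegrable _ _)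
  have hint2 : IntervalIntegrable (fun t => MV t * (kern₁ t * T * TrW t)) volume (-H) H :=
    ((hMVc.mul ((hkc.mul continuous_const).mul hTrWc)).intervalIntegrable _ _)
  have hd : ‖(1 / (2 * π)) • (∫ t in -H..H, MV t * (kern₁ t * T * W t v)) -
      (1 / (2 * π)) • ∫ t in -H..H, MV t * (kern₁ t * T * TrW t)‖ ≤
      1 / (2 * π) * (2 * H) * DV * T * τB := by
    rw [← smul_sub, ← intervalIntegral.integral_sub hint1 hint2, norm_smul, Real.norm_eq_abs,
      abs_of_pos (by positivity)]
    have hbound : ∀ t ∈ Set.uIoc (-H) H,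
        ‖MV t * (kern₁ t * T * W t v) - MV t * (kern₁ t * T * TrW t)‖ ≤ DV * T * τB := by
      intro t ht
      rw [Set.uIoc_of_le (by linarith)] at ht
      have htI : t ∈ Set.Icc (-H) H := Set.Ioc_subset_Icc_self ht
      have hsub : MV t * (kern₁ t * T * W t v) - MV t * (kern₁ t * T * TrW t) =
          MV t * kern₁ t * T * (W t v - TrW t) := by ring
      rw [hsub, norm_mul, norm_mul, norm_mul, Complex.norm_real, Real.norm_eq_abs, abs_of_pos hT]
      have h1 := hMVb t
      have h2 := hkb t
      have h3 := hWexp t htI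
      calc ‖MV t‖ * ‖kern₁ t‖ * T * ‖W t v - TrW t‖ ≤ DV * 1 * T * τB := by
            gcongr
        _ = DV * T * τB := by ring
    have h := intervalIntegral.norm_integral_le_of_norm_le_const hbound
    have habs : |H - -H| = 2 * H := by rw [sub_neg_eq_add, abs_of_nonneg (by linarith)]; ring
    rw [habs] at h
    calc 1 / (2 * π) * ‖∫ t in -H..H, MV t * (kern₁ t * T * W t v) - MV t * (kern₁ t * T * TrW t)‖
        ≤ 1 / (2 * π) * (DV * T * τB * (2 * H)) := by gcongr
      _ = 1 / (2 * π) * (2 * H) * DV * T * τB := by ring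
  -- assemble
  have hsplit : P * Nh * V Y * Wb -
      P * ((Nh : ℂ) * (T : ℂ) * (1 / (2 * (π : ℂ))) ^ 2) *
        (∫ t in -H..H, ∫ t' in -H..H, MV t * MW t t' * (kern₁ t * ((v : ℝ) : ℂ) ^ (-(t' * I)))) =
      (P * Nh * V Y * Wb - P * Nh * Tr * Wb) +
        P * Nh * ((1 / (2 * π)) • (∫ t in -H..H, MV t * (kern₁ t * T * W t v)) -
          (1 / (2 * π)) • ∫ t in -H..H, MV t * (kern₁ t * T * TrW t)) := by
    rw [← hb, ← hc]; ring
  rw [hsplit]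
  calc ‖(P * Nh * V Y * Wb - P * Nh * Tr * Wb) +
        P * Nh * ((1 / (2 * π)) • (∫ t in -H..H, MV t * (kern₁ t * T * W t v)) -
          (1 / (2 * π)) • ∫ t in -H..H, MV t * (kern₁ t * T * TrW t))‖
      ≤ ‖P * Nh * V Y * Wb - P * Nh * Tr * Wb‖ +
        ‖P * Nh * ((1 / (2 * π)) • (∫ t in -H..H, MV t * (kern₁ t * T * W t v)) -
          (1 / (2 * π)) • ∫ t in -H..H, MV t * (kern₁ t * T * TrW t))‖ := norm_add_le _ _
    _ ≤ ‖P‖ * Nh * (τA * ‖Wb‖) + ‖P‖ * Nh * (1 / (2 * π) * (2 * H) * DV * T * τB) := by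
        refine add_le_add ha ?_
        rw [norm_mul, norm_mul, hNh']
        gcongr
    _ = ‖P‖ * Nh * (τA * ‖Wb‖ + 1 / (2 * π) * (2 * H) * DV * T * τB) := by ring


/-! ### C. One box: factorisation of the summand, insertion of the `n`- and `u`-partitions -/

/-- `√(kmn) = √k √m √n` for naturals. [folklore] -/
private theorem sqrt_mul_three (k m n : ℕ) :
    Real.sqrt ((k : ℝ) * m * n) = Real.sqrt k * Real.sqrt m * Real.sqrt n := by
  rw [Real.sqrt_mul (by positivity), Real.sqrt_mul (by positivity)]

/-- **The shift variable**: for `k, m ≥ 1` and an integer `n = km + s r ≥ 1`, with `u = r/(km)`: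
`1 + s u = n/(km) > 0` and `log(km/n) = −log(1 + s u)`.
[cite: BondarenkoHeap2026, §6.2, TeX l.753–763] -/
theorem one_add_shift_eq {k m r n : ℕ} {s : ℤ} (hk : 1 ≤ k) (hm : 1 ≤ m)
    (hn : (n : ℤ) = k * m + s * r) :
    1 + (s : ℝ) * ((r : ℝ) / ((k : ℝ) * m)) = (n : ℝ) / ((k : ℝ) * m) := by
  have hk0 : (0 : ℝ) < k := by exact_mod_cast hk
  have hm0 : (0 : ℝ) < m := by exact_mod_cast hm
  have hkm : (0 : ℝ) < (k : ℝ) * m := mul_pos hk0 hm0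
  have hn' : (n : ℝ) = (k : ℝ) * m + (s : ℝ) * r := by exact_mod_cast hn
  rw [hn']; field_simp

/-- `log(km/n) = −log(1 + s u)` in the situation of `one_add_shift_eq`, `n ≥ 1`.
[cite: BondarenkoHeap2026, §6.2, TeX l.753–763] -/
theorem log_div_eq_neg_log_one_add_shift {k m r n : ℕ} {s : ℤ} (hk : 1 ≤ k) (hm : 1 ≤ m)
    (hn1 : 1 ≤ n) (hn : (n : ℤ) = k * m + s * r) :
    Real.log ((k : ℝ) * m / n) = -Real.log (1 + (s : ℝ) * ((r : ℝ) / ((k : ℝ) * m))) := by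
  have hk0 : (0 : ℝ) < k := by exact_mod_cast hk
  have hm0 : (0 : ℝ) < m := by exact_mod_cast hm
  have hn0 : (0 : ℝ) < n := by exact_mod_cast hn1
  have hkm : (0 : ℝ) < (k : ℝ) * m := mul_pos hk0 hm0
  rw [one_add_shift_eq hk hm hn, ← Real.log_inv, inv_div]

/-- **Factorisation of one smoothed summand of `𝒪𝒟`** (the display `\label{OD term}` and the
definition of `F(k,m,r)`, TeX l.752–763, with `χ` quadratic so that the real parts `Re χ(m)`,
`Re χ(n)` of the resonator coefficients are the character values): for `k, m, n ≥ 1` with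
`n = km + s r`, `ω(k/K)² ω(m/M)² ω(r/R)² · jTerm(k,m,n) = Λ(k) χ(m) χ(km+sr) ·
[g_h(k) k^{−1/2} ω(k/K)²] · [G(m) m^{−1/2} ω(m/M)²] · ω(r/R)² · [G(n) n^{−1/2}] · Ŵ_T(log(1+su)/2π)`
as complex numbers. [cite: BondarenkoHeap2026, §6.2, TeX l.752–763] -/
theorem bumps_mul_jTerm_eq {q : ℕ} {χ : DirichletCharacter ℂ q} (hχ : χ.IsQuadratic) (c : ℝ)
    (w : Bump) (B : ℕ) (ρ : Resonator) (T K M R : ℝ) {s : ℤ} {k m r n : ℕ} (hk : 1 ≤ k)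
    (hm : 1 ≤ m) (hn1 : 1 ≤ n) (hn : (n : ℤ) = k * m + s * r) :
    ((SmoothDyadicPartition.bump ((k : ℝ) / K) ^ 2 * SmoothDyadicPartition.bump ((m : ℝ) / M) ^ 2 *
        SmoothDyadicPartition.bump ((r : ℝ) / R) ^ 2 * jTerm c w B (ρ.coeff χ) T k m n : ℝ) : ℂ) =
      ((Λ k : ℝ) : ℂ) * (χ (m : ZMod q) * χ (((k : ℤ) * m + s * r : ℤ) : ZMod q)) *
        ((gWeight (gapWidth c T) k / Real.sqrt k * SmoothDyadicPartition.bump ((k : ℝ) / K) ^ 2 : ℝ) : ℂ) *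
        ((ρ.G q m / Real.sqrt m * SmoothDyadicPartition.bump ((m : ℝ) / M) ^ 2 : ℝ) : ℂ) *
        ((SmoothDyadicPartition.bump ((r : ℝ) / R) ^ 2 : ℝ) : ℂ) *
        ((ρ.G q n / Real.sqrt n : ℝ) : ℂ) *
        ((weightHat w B T (Real.log (1 + (s : ℝ) * ((r : ℝ) / ((k : ℝ) * m))) / (2 * π)) : ℝ) : ℂ) := by
  have hcast : (((k : ℤ) * m + s * r : ℤ) : ZMod q) = ((n : ℕ) : ZMod q) := by
    rw [← hn]; simp
  rw [hcast, jTerm, Resonator.coeff, Resonator.coeff, sqrt_mul_three,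
    log_div_eq_neg_log_one_add_shift hk hm hn1 hn, neg_div, weightHat_even]
  simp only [div_eq_mul_inv, mul_inv]
  push_cast
  rw [re_quadratic hχ, re_quadratic hχ]
  ring


/-! ### D. The main terms: kernel algebra, exchange, emergence of `E(K,M,R)` -/

/-- **Kernel algebra** (the factors `(K/k)^{s₁}(M/m)^{s₂}(R/r)^{s₃}` of the display after TeX
l.799): with
`u = r/(km)`, the product of the `n`-kernel `(k/K)^{−it}(m/M)^{−it}(KM/N)^{−it}` and the `u`-kernel
`(u/U)^{−it'}` regroups as `(KM/N)^{−it} (R/(KMU))^{−it'} · (k/K)^{−i(t−t')} (m/M)^{−i(t−t')} (r/R)^{−it'}`.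
[cite: BondarenkoHeap2026, §6.2, TeX l.799–808] -/
theorem kernel_regroup {k m r : ℕ} (hk : 1 ≤ k) (hm : 1 ≤ m) (hr : 1 ≤ r) {K M R Nν Uμ : ℝ}
    (hK : 0 < K) (hM : 0 < M) (hR : 0 < R) (hU : 0 < Uμ) (t t' : ℝ) :
    ((((k : ℝ) / K : ℝ)) : ℂ) ^ (-(t * I)) * ((((m : ℝ) / M : ℝ)) : ℂ) ^ (-(t * I)) *
        (((K * M / Nν : ℝ)) : ℂ) ^ (-(t * I)) *
        ((((r : ℝ) / ((k : ℝ) * m) / Uμ : ℝ)) : ℂ) ^ (-(t' * I)) =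
      (((K * M / Nν : ℝ)) : ℂ) ^ (-(t * I)) * (((R / (K * M * Uμ) : ℝ)) : ℂ) ^ (-(t' * I)) *
        (((((k : ℝ) / K : ℝ)) : ℂ) ^ (-((t - t') * I)) * ((((m : ℝ) / M : ℝ)) : ℂ) ^ (-((t - t') * I)) *
          ((((r : ℝ) / R : ℝ)) : ℂ) ^ (-(t' * I))) := by
  have hk0 : (0 : ℝ) < k := by exact_mod_cast hk
  have hm0 : (0 : ℝ) < m := by exact_mod_cast hm
  have hr0 : (0 : ℝ) < r := by exact_mod_cast hr
  have hkK : (0 : ℝ) < (k : ℝ) / K := div_pos hk0 hK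
  have hmM : (0 : ℝ) < (m : ℝ) / M := div_pos hm0 hM
  -- `u/U = (r/R) · (k/K)⁻¹ · (m/M)⁻¹ · (R/(KMU))`
  have hu : (r : ℝ) / ((k : ℝ) * m) / Uμ =
      ((r : ℝ) / R * (R / (K * M * Uμ))) * (((k : ℝ) / K)⁻¹ * ((m : ℝ) / M)⁻¹) := by
    field_simp
  rw [hu, ofReal_mul_cpow (by positivity) (by positivity), ofReal_mul_cpow (by positivity) (by positivity),
    ofReal_mul_cpow (by positivity) (by positivity), ofReal_inv_cpow hkK, ofReal_inv_cpow hmM, neg_neg]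
  -- `x^{−it} · x^{it'} = x^{−i(t−t')}`
  have hkne : ((((k : ℝ) / K : ℝ)) : ℂ) ≠ 0 := by exact_mod_cast hkK.ne'
  have hmne : ((((m : ℝ) / M : ℝ)) : ℂ) ≠ 0 := by exact_mod_cast hmM.ne'
  have hexp : -((t - t') * I) = -(t * I) + t' * I := by ring
  rw [hexp, Complex.cpow_add _ _ hkne, Complex.cpow_add _ _ hmne]
  ring


/-- Joint continuity of the double-integral integrand of one main piece. [folklore] -/
private theorem continuous_mainIntegrand {MV : ℝ → ℂ} {MW : ℝ → ℝ → ℂ} (hMVc : Continuous MV)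
    (hMWc : Continuous (Function.uncurry MW)) (C : ℂ) {x y z v : ℝ} (hx : 0 < x) (hy : 0 < y)
    (hz : 0 < z) (hv : 0 < v) :
    Continuous (Function.uncurry fun t t' : ℝ =>
      C * (MV t * MW t t' * (((x : ℝ) : ℂ) ^ (-(t * I)) * ((y : ℝ) : ℂ) ^ (-(t * I)) *
        ((z : ℝ) : ℂ) ^ (-(t * I)) * ((v : ℝ) : ℂ) ^ (-(t' * I))))) := by
  have hcp : ∀ {a : ℝ}, 0 < a → Continuous fun t : ℝ => ((a : ℝ) : ℂ) ^ (-(t * I)) := fun ha =>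
    Continuous.const_cpow (by fun_prop) (Or.inl (by exact_mod_cast ha.ne'))
  refine continuous_const.mul ((((hMVc.comp continuous_fst).mul hMWc)).mul ?_)
  exact ((((hcp hx).comp continuous_fst).mul ((hcp hy).comp continuous_fst)).mul
    ((hcp hz).comp continuous_fst)).mul ((hcp hv).comp continuous_snd)

/-- A finite sum of jointly continuous two-variable functions is jointly continuous. [folklore] -/
private theorem continuous_uncurry_sum {ι : Type*} (S : Finset ι) {F : ι → ℝ → ℝ → ℂ}
    (hF : ∀ i ∈ S, Continuous (Function.uncurry (F i))) :
    Continuous (Function.uncurry fun t t' : ℝ => ∑ i ∈ S, F i t t') := by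
  change Continuous fun p : ℝ × ℝ => ∑ i ∈ S, F i p.1 p.2
  exact continuous_finsetSum _ fun i hi => hF i hi

/-- **Exchange and emergence of `E(K,M,R)`** ("pushing the sum through the integral we acquire,
after relabelling `a_k,b_m` and renormalising coefficients, an inner sum of the form" — display —
`(q^ε T/KM) Σ_{k,m,r} a_k Λ(k) b_m c_r χ(m) χ(km+r)`, TeX l.827–830): the sum over the box of the
main pieces is one double integral of `𝓜V(it) 𝓜W_t(it')` times the correlation sum `corrSumE` of
the separated weights. [cite: BondarenkoHeap2026, §6.2, TeX l.827–830] -/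
theorem sum_mainPiece_eq {q : ℕ} (χ : DirichletCharacter ℂ q) (s : ℤ) {K M R Nν Uμ : ℝ}
    (hK : 0 < K) (hM : 0 < M) (hR : 0 < R) (hN : 0 < Nν) (hU : 0 < Uμ) (T H : ℝ)
    {MV : ℝ → ℂ} {MW : ℝ → ℝ → ℂ} (hMVc : Continuous MV) (hMWc : Continuous (Function.uncurry MW))
    (Pk Pm Pr : ℕ → ℂ) (α β γ : ℂ → ℝ → ℂ) (cA cB : ℂ)
    (hα : ∀ (z : ℂ) (k : ℕ), 1 ≤ k → Pk k * ((((k : ℝ) / K : ℝ)) : ℂ) ^ (-z) = cA * α z k)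
    (hβ : ∀ (z : ℂ) (m : ℕ), 1 ≤ m → Pm m * ((((m : ℝ) / M : ℝ)) : ℂ) ^ (-z) = cB * β z m)
    (hγ : ∀ (z : ℂ) (r : ℕ), 1 ≤ r → Pr r * ((((r : ℝ) / R : ℝ)) : ℂ) ^ (-z) = γ z r) :
    (∑ k ∈ Icc 1 ⌊2 * K⌋₊, ∑ m ∈ Icc 1 ⌊2 * M⌋₊, ∑ r ∈ Icc 1 ⌊2 * R⌋₊,
      ((Λ k : ℝ) : ℂ) * (χ (m : ZMod q) * χ (((k : ℤ) * m + s * r : ℤ) : ZMod q)) * Pk k * Pm m *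
          Pr r * ((((Nν ^ (-(1 / 2 : ℝ)) : ℝ)) : ℂ) * (T : ℂ) * (1 / (2 * (π : ℂ))) ^ 2) *
        ∫ t in -H..H, ∫ t' in -H..H, MV t * MW t t' *
          (((((k : ℝ) / K : ℝ)) : ℂ) ^ (-(t * I)) * ((((m : ℝ) / M : ℝ)) : ℂ) ^ (-(t * I)) *
            (((K * M / Nν : ℝ)) : ℂ) ^ (-(t * I)) *
            ((((r : ℝ) / ((k : ℝ) * m) / Uμ : ℝ)) : ℂ) ^ (-(t' * I)))) =
      cA * cB * ((((Nν ^ (-(1 / 2 : ℝ)) : ℝ)) : ℂ) * (T : ℂ) * (1 / (2 * (π : ℂ))) ^ 2) *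
        ∫ t in -H..H, ∫ t' in -H..H, MV t * MW t t' *
          ((((K * M / Nν : ℝ)) : ℂ) ^ (-(t * I)) * (((R / (K * M * Uμ) : ℝ)) : ℂ) ^ (-(t' * I))) *
          corrSumE χ s K M R (α ((t - t') * I)) (β ((t - t') * I)) (γ (t' * I)) := by
  -- move the constants inside the double integrals
  have hconst : ∀ (C : ℂ) (F : ℝ → ℝ → ℂ),
      C * ∫ t in -H..H, ∫ t' in -H..H, F t t' = ∫ t in -H..H, ∫ t' in -H..H, C * F t t' := by
    intro C F
    rw [← intervalIntegral.integral_const_mul]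
    refine intervalIntegral.integral_congr fun t _ => ?_
    exact (intervalIntegral.integral_const_mul C _).symm
  simp_rw [hconst]
  -- exchange the three finite sums with the double integral
  have hcont : ∀ k ∈ Finset.Icc 1 ⌊2 * K⌋₊, ∀ m ∈ Finset.Icc 1 ⌊2 * M⌋₊,
      ∀ r ∈ Finset.Icc 1 ⌊2 * R⌋₊,
      Continuous (Function.uncurry fun t t' : ℝ =>
        ((Λ k : ℝ) : ℂ) * (χ (m : ZMod q) * χ (((k : ℤ) * m + s * r : ℤ) : ZMod q)) * Pk k * Pm m *
            Pr r * ((((Nν ^ (-(1 / 2 : ℝ)) : ℝ)) : ℂ) * (T : ℂ) * (1 / (2 * (π : ℂ))) ^ 2) *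
          (MV t * MW t t' *
            (((((k : ℝ) / K : ℝ)) : ℂ) ^ (-(t * I)) * ((((m : ℝ) / M : ℝ)) : ℂ) ^ (-(t * I)) *
              (((K * M / Nν : ℝ)) : ℂ) ^ (-(t * I)) *
              ((((r : ℝ) / ((k : ℝ) * m) / Uμ : ℝ)) : ℂ) ^ (-(t' * I))))) := by
    intro k hk m hm r hr
    have hk0 : (0 : ℝ) < k := Nat.cast_pos.mpr (Finset.mem_Icc.mp hk).1
    have hm0 : (0 : ℝ) < m := Nat.cast_pos.mpr (Finset.mem_Icc.mp hm).1
    have hr0 : (0 : ℝ) < r := Nat.cast_pos.mpr (Finset.mem_Icc.mp hr).1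
    exact continuous_mainIntegrand hMVc hMWc _ (div_pos hk0 hK) (div_pos hm0 hM) (by positivity)
      (by positivity)
  rw [Finset.sum_congr rfl fun k hk => Finset.sum_congr rfl fun m hm =>
    sum_intervalIntegral₂_eq (Finset.Icc 1 ⌊2 * R⌋₊) (fun r hr => hcont k hk m hm r hr) (-H) H]
  rw [Finset.sum_congr rfl fun k hk => sum_intervalIntegral₂_eq (Finset.Icc 1 ⌊2 * M⌋₊)
    (fun m hm => continuous_uncurry_sum _ fun r hr => hcont k hk m hm r hr) (-H) H]
  rw [sum_intervalIntegral₂_eq (Finset.Icc 1 ⌊2 * K⌋₊)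
    (fun k hk => continuous_uncurry_sum _ fun m hm => continuous_uncurry_sum _ fun r hr =>
      hcont k hk m hm r hr) (-H) H]
  -- pointwise identity inside the double integral
  refine intervalIntegral.integral_congr fun t _ => intervalIntegral.integral_congr fun t' _ => ?_
  have hE := sum_eq_mul_corrSumE χ s K M R Pk Pm Pr (α ((t - t') * I)) (β ((t - t') * I))
    (γ (t' * I)) ((t - t') * I) ((t - t') * I) (t' * I) cA cB (fun k hk => hα _ k hk)
    (fun m hm => hβ _ m hm) (fun r hr => hγ _ r hr)
  set C₀ : ℂ := (((Nν ^ (-(1 / 2 : ℝ)) : ℝ)) : ℂ) * (T : ℂ) * (1 / (2 * (π : ℂ))) ^ 2 with hC₀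
  set Z : ℂ := MV t * MW t t' *
    ((((K * M / Nν : ℝ)) : ℂ) ^ (-(t * I)) * (((R / (K * M * Uμ) : ℝ)) : ℂ) ^ (-(t' * I))) with hZ
  calc _ = C₀ * Z * ∑ k ∈ Finset.Icc 1 ⌊2 * K⌋₊, ∑ m ∈ Finset.Icc 1 ⌊2 * M⌋₊,
        ∑ r ∈ Finset.Icc 1 ⌊2 * R⌋₊,
          ((Λ k : ℝ) : ℂ) * (χ (m : ZMod q) * χ (((k : ℤ) * m + s * r : ℤ) : ZMod q)) *
            (Pk k * ((((k : ℝ) / K : ℝ)) : ℂ) ^ (-((t - t') * I))) *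
            (Pm m * ((((m : ℝ) / M : ℝ)) : ℂ) ^ (-((t - t') * I))) *
            (Pr r * ((((r : ℝ) / R : ℝ)) : ℂ) ^ (-(t' * I))) := by
        rw [Finset.mul_sum]
        refine Finset.sum_congr rfl fun k hk => ?_
        rw [Finset.mul_sum]
        refine Finset.sum_congr rfl fun m hm => ?_
        rw [Finset.mul_sum]
        refine Finset.sum_congr rfl fun r hr => ?_
        rw [kernel_regroup (Finset.mem_Icc.mp hk).1 (Finset.mem_Icc.mp hm).1 (Finset.mem_Icc.mp hr).1
          hK hM hR hU t t']
        simp only [hC₀, hZ]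
        ring
    _ = C₀ * Z * (cA * cB * corrSumE χ s K M R (α ((t - t') * I)) (β ((t - t') * I)) (γ (t' * I))) := by
        rw [hE]
    _ = _ := by simp only [hC₀, hZ]; ring


/-! ### E. One summand: insertion of the `n`- and `u`-partitions, and the error of one piece -/

open SmoothDyadicPartition (bump bump_nonneg bump_le_one)

/-- `ω(x)² ≤ 1`. [folklore] -/
private theorem bump_sq_le_one (x : ℝ) : bump x ^ 2 ≤ 1 := by
  have h0 := bump_nonneg x
  have h1 := bump_le_one x
  nlinarith

/-- **One summand as a double sum of pieces** ("a dyadic partition of unity of the form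
`∑_X ω(x/X)² = 1` in each variable", TeX l.751 — applied here, in our rendering, once more in
`n = km + sr` and in `u = r/(km)`): with
`Σ_ν ω(n/N_ν)² = 1`, `Σ_μ ω(u/U_μ)² = 1` and the profile identity
`G(n) n^{−1/2} ω(n/N)² = N^{−1/2} V_N(n/N)`, the factorised summand of `bumps_mul_jTerm_eq` equals
`Σ_ν Σ_μ Λ(k)χ(m)χ(km+sr) · P_k P_m ω(r/R)² · N_ν^{−1/2} V_{N_ν}(n/N_ν) · [Ŵ_T(log(1+su)/2π) ω(u/U_μ)²]`.
[cite: BondarenkoHeap2026, §6.2, TeX l.751–763] -/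
theorem bumps_mul_jTerm_eq_sum_pieces {q : ℕ} {χ : DirichletCharacter ℂ q} (hχ : χ.IsQuadratic)
    (c : ℝ) (w : Bump) (B : ℕ) (ρ : Resonator) (T K M R : ℝ) {s : ℤ} {k m r n : ℕ} (hk : 1 ≤ k)
    (hm : 1 ≤ m) (hn1 : 1 ≤ n) (hn : (n : ℤ) = k * m + s * r) (Iν Iμ : Finset ℤ) (N U : ℤ → ℝ)
    (V : ℤ → ℝ → ℂ)
    (hpartN : ∑ ν ∈ Iν, bump ((n : ℝ) / N ν) ^ 2 = 1)
    (hpartU : ∑ μ ∈ Iμ, bump ((r : ℝ) / ((k : ℝ) * m) / U μ) ^ 2 = 1)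
    (hVid : ∀ ν ∈ Iν, ((ρ.G q n / Real.sqrt n * bump ((n : ℝ) / N ν) ^ 2 : ℝ) : ℂ) =
      (((N ν) ^ (-(1 / 2 : ℝ)) : ℝ) : ℂ) * V ν ((n : ℝ) / N ν)) :
    ((bump ((k : ℝ) / K) ^ 2 * bump ((m : ℝ) / M) ^ 2 * bump ((r : ℝ) / R) ^ 2 *
        jTerm c w B (ρ.coeff χ) T k m n : ℝ) : ℂ) =
      ∑ ν ∈ Iν, ∑ μ ∈ Iμ,
        ((Λ k : ℝ) : ℂ) * (χ (m : ZMod q) * χ (((k : ℤ) * m + s * r : ℤ) : ZMod q)) *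
          ((gWeight (gapWidth c T) k / Real.sqrt k * bump ((k : ℝ) / K) ^ 2 : ℝ) : ℂ) *
          ((ρ.G q m / Real.sqrt m * bump ((m : ℝ) / M) ^ 2 : ℝ) : ℂ) *
          ((bump ((r : ℝ) / R) ^ 2 : ℝ) : ℂ) *
          (((N ν) ^ (-(1 / 2 : ℝ)) : ℝ) : ℂ) * V ν ((n : ℝ) / N ν) *
          ((weightHat w B T (Real.log (1 + (s : ℝ) * ((r : ℝ) / ((k : ℝ) * m))) / (2 * π)) *
              bump ((r : ℝ) / ((k : ℝ) * m) / U μ) ^ 2 : ℝ) : ℂ) := by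
  rw [bumps_mul_jTerm_eq hχ c w B ρ T K M R hk hm hn1 hn]
  -- `G(n)/√n = Σ_ν N_ν^{-1/2} V_ν(n/N_ν)` and `Ŵ = Σ_μ Ŵ ω(u/U_μ)²`
  have hGn : ((ρ.G q n / Real.sqrt n : ℝ) : ℂ) =
      ∑ ν ∈ Iν, (((N ν) ^ (-(1 / 2 : ℝ)) : ℝ) : ℂ) * V ν ((n : ℝ) / N ν) := by
    rw [← Finset.sum_congr rfl hVid]
    push_cast
    rw [← Finset.mul_sum]
    have h1 : ∑ ν ∈ Iν, ((bump ((n : ℝ) / N ν) : ℂ)) ^ 2 = 1 := by exact_mod_cast hpartN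
    rw [h1, mul_one]
  have hW : ((weightHat w B T (Real.log (1 + (s : ℝ) * ((r : ℝ) / ((k : ℝ) * m))) / (2 * π)) : ℝ) : ℂ) =
      ∑ μ ∈ Iμ, ((weightHat w B T (Real.log (1 + (s : ℝ) * ((r : ℝ) / ((k : ℝ) * m))) / (2 * π)) *
        bump ((r : ℝ) / ((k : ℝ) * m) / U μ) ^ 2 : ℝ) : ℂ) := by
    push_cast
    rw [← Finset.mul_sum]
    have h1 : ∑ μ ∈ Iμ, ((bump ((r : ℝ) / ((k : ℝ) * m) / U μ) : ℂ)) ^ 2 = 1 := by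
      exact_mod_cast hpartU
    rw [h1, mul_one]
  rw [hGn, hW]
  simp_rw [Finset.mul_sum, Finset.sum_mul]
  rw [Finset.sum_comm]
  refine Finset.sum_congr rfl fun ν _ => Finset.sum_congr rfl fun μ _ => ?_
  ring

/-- **Error of one piece** ("This gives a negligible error `O(T^{-C})` by the rapid decay", TeX
l.825; here with explicit constants): for a summand with `k, m ≥ 1`, `n = km + sr ≥ 1` and a piece
`(ν, μ)`, the difference between the piece and its doubly-truncated main part is at most
`log k · g_B · G_B · N₀^{−1/2} · (τ_A W_B + (1/2π)(2H) D_V T τ_B)`.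
[cite: BondarenkoHeap2026, §6.2, TeX l.825–827] -/
theorem piece_diff_bound {q : ℕ} (χ : DirichletCharacter ℂ q) (c : ℝ) (w : Bump) (B : ℕ)
    (ρ : Resonator) {T K M R Nν Uμ N₀ : ℝ} (hT : 0 < T) (hK : 0 < K) (hM : 0 < M)
    (hNν : 0 < Nν) (hN₀ : 0 < N₀) (hN₀ν : N₀ ≤ Nν) (hU : 0 < Uμ) {s : ℤ} {k m r n : ℕ} (hk : 1 ≤ k)
    (hm : 1 ≤ m) (hr : 1 ≤ r) (hn1 : 1 ≤ n) (hn : (n : ℤ) = k * m + s * r)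
    {V MV : ℝ → ℂ} {W MW : ℝ → ℝ → ℂ}
    (hWid : ∀ t u : ℝ, 0 < u → 0 < 1 + (s : ℝ) * u →
      ((weightHat w B T (Real.log (1 + (s : ℝ) * u) / (2 * π)) * bump (u / Uμ) ^ 2 : ℝ) : ℂ) *
          (((1 + (s : ℝ) * u : ℝ)) : ℂ) ^ (-(t * I)) = (T : ℂ) * W t (u / Uμ))
    (hWc : ∀ v : ℝ, Continuous fun t => W t v)
    {H τA τB DV gB GB WB : ℝ} (hH : 0 < H) (hτA : 0 ≤ τA) (hτB : 0 ≤ τB) (hDV : 0 ≤ DV)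
    (hVexp : ∀ y : ℝ, 0 < y →
      ‖V y - (1 / (2 * π)) • ∫ t in -H..H, MV t * ((y : ℝ) : ℂ) ^ (-(t * I))‖ ≤ τA)
    (hMVc : Continuous MV) (hMVb : ∀ t, ‖MV t‖ ≤ DV)
    (hWexp : ∀ t ∈ Set.Icc (-H) H, ∀ v : ℝ, 0 < v →
      ‖W t v - (1 / (2 * π)) • ∫ t' in -H..H, MW t t' * ((v : ℝ) : ℂ) ^ (-(t' * I))‖ ≤ τB)
    (hMWc : Continuous (Function.uncurry MW))
    (hg : ∀ k : ℕ, |gWeight (gapWidth c T) k| ≤ gB) (hG : ∀ n : ℕ, |ρ.G q n| ≤ GB)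
    (hWB : ∀ ξ : ℝ, |weightHat w B T ξ| ≤ WB) :
    ‖((Λ k : ℝ) : ℂ) * (χ (m : ZMod q) * χ (((k : ℤ) * m + s * r : ℤ) : ZMod q)) *
          ((gWeight (gapWidth c T) k / Real.sqrt k * bump ((k : ℝ) / K) ^ 2 : ℝ) : ℂ) *
          ((ρ.G q m / Real.sqrt m * bump ((m : ℝ) / M) ^ 2 : ℝ) : ℂ) *
          ((bump ((r : ℝ) / R) ^ 2 : ℝ) : ℂ) *
          ((Nν ^ (-(1 / 2 : ℝ)) : ℝ) : ℂ) * V ((n : ℝ) / Nν) *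
          ((weightHat w B T (Real.log (1 + (s : ℝ) * ((r : ℝ) / ((k : ℝ) * m))) / (2 * π)) *
              bump ((r : ℝ) / ((k : ℝ) * m) / Uμ) ^ 2 : ℝ) : ℂ) -
        ((Λ k : ℝ) : ℂ) * (χ (m : ZMod q) * χ (((k : ℤ) * m + s * r : ℤ) : ZMod q)) *
          ((gWeight (gapWidth c T) k / Real.sqrt k * bump ((k : ℝ) / K) ^ 2 : ℝ) : ℂ) *
          ((ρ.G q m / Real.sqrt m * bump ((m : ℝ) / M) ^ 2 : ℝ) : ℂ) *
          ((bump ((r : ℝ) / R) ^ 2 : ℝ) : ℂ) *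
          ((((Nν ^ (-(1 / 2 : ℝ)) : ℝ)) : ℂ) * (T : ℂ) * (1 / (2 * (π : ℂ))) ^ 2) *
          ∫ t in -H..H, ∫ t' in -H..H, MV t * MW t t' *
            (((((k : ℝ) / K : ℝ)) : ℂ) ^ (-(t * I)) * ((((m : ℝ) / M : ℝ)) : ℂ) ^ (-(t * I)) *
              (((K * M / Nν : ℝ)) : ℂ) ^ (-(t * I)) *
              ((((r : ℝ) / ((k : ℝ) * m) / Uμ : ℝ)) : ℂ) ^ (-(t' * I)))‖ ≤
      Real.log k * gB * GB * N₀ ^ (-(1 / 2 : ℝ)) *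
        (τA * WB + 1 / (2 * π) * (2 * H) * DV * T * τB) := by
  have hk0 : (0 : ℝ) < k := Nat.cast_pos.mpr hk
  have hm0 : (0 : ℝ) < m := Nat.cast_pos.mpr hm
  have hr0 : (0 : ℝ) < r := Nat.cast_pos.mpr hr
  have hn0 : (0 : ℝ) < n := Nat.cast_pos.mpr hn1
  have hkm : (0 : ℝ) < (k : ℝ) * m := mul_pos hk0 hm0
  set u : ℝ := (r : ℝ) / ((k : ℝ) * m) with hu
  have hu0 : 0 < u := div_pos hr0 hkm
  have h1su : 1 + (s : ℝ) * u = (n : ℝ) / ((k : ℝ) * m) := one_add_shift_eq hk hm hn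
  have h1su0 : 0 < 1 + (s : ℝ) * u := by rw [h1su]; positivity
  -- the data of `piece_expansion_bound`
  set P : ℂ := ((Λ k : ℝ) : ℂ) * (χ (m : ZMod q) * χ (((k : ℤ) * m + s * r : ℤ) : ZMod q)) *
      ((gWeight (gapWidth c T) k / Real.sqrt k * bump ((k : ℝ) / K) ^ 2 : ℝ) : ℂ) *
      ((ρ.G q m / Real.sqrt m * bump ((m : ℝ) / M) ^ 2 : ℝ) : ℂ) *
      ((bump ((r : ℝ) / R) ^ 2 : ℝ) : ℂ) with hP
  set Wb : ℂ := ((weightHat w B T (Real.log (1 + (s : ℝ) * u) / (2 * π)) * bump (u / Uμ) ^ 2 : ℝ) : ℂ)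
    with hWb
  set Y : ℝ := (n : ℝ) / Nν with hY
  have hY0 : 0 < Y := div_pos hn0 hNν
  set v : ℝ := u / Uμ with hv
  have hv0 : 0 < v := div_pos hu0 hU
  set kern₁ : ℝ → ℂ := fun t => ((((k : ℝ) / K : ℝ)) : ℂ) ^ (-(t * I)) *
      ((((m : ℝ) / M : ℝ)) : ℂ) ^ (-(t * I)) * (((K * M / Nν : ℝ)) : ℂ) ^ (-(t * I)) with hkern
  have hcp : ∀ {a : ℝ}, 0 < a → Continuous fun t : ℝ => ((a : ℝ) : ℂ) ^ (-(t * I)) := fun ha =>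
    Continuous.const_cpow (by fun_prop) (Or.inl (by exact_mod_cast ha.ne'))
  have hkc : Continuous kern₁ :=
    ((hcp (div_pos hk0 hK)).mul (hcp (div_pos hm0 hM))).mul (hcp (by positivity))
  have hkb : ∀ t, ‖kern₁ t‖ ≤ 1 := by
    intro t
    simp only [hkern, norm_mul, norm_ofReal_cpow_neg_mul_I (div_pos hk0 hK),
      norm_ofReal_cpow_neg_mul_I (div_pos hm0 hM),
      norm_ofReal_cpow_neg_mul_I (show (0 : ℝ) < K * M / Nν by positivity)]
    norm_num
  -- `Y = (k/K)(m/M)(KM/N)(1+su)`, hence the separation identity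
  have hYfac : Y = ((k : ℝ) / K * ((m : ℝ) / M)) * (K * M / Nν) * (1 + (s : ℝ) * u) := by
    rw [h1su, hY]; field_simp
  have hWid' : ∀ t : ℝ, ((Y : ℝ) : ℂ) ^ (-(t * I)) * Wb = kern₁ t * T * W t v := by
    intro t
    rw [hYfac, ofReal_mul_cpow (by positivity) h1su0.le, ofReal_mul_cpow (by positivity) (by positivity),
      ofReal_mul_cpow (by positivity) (by positivity)]
    have h := hWid t u hu0 h1su0
    rw [← hWb, ← hv] at h
    simp only [hkern]
    calc _ = ((((k : ℝ) / K : ℝ)) : ℂ) ^ (-(t * I)) * ((((m : ℝ) / M : ℝ)) : ℂ) ^ (-(t * I)) *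
          (((K * M / Nν : ℝ)) : ℂ) ^ (-(t * I)) * (Wb * (((1 + (s : ℝ) * u : ℝ)) : ℂ) ^ (-(t * I))) := by
          ring
      _ = _ := by rw [h]; ring
  have hWcv : Continuous fun t => W t v := hWc v
  have hmain := piece_expansion_bound (P := P) (Wb := Wb) (Nh := Nν ^ (-(1 / 2 : ℝ))) (T := T)
    (Y := Y) (v := v) (H := H) (τA := τA) (τB := τB) (DV := DV) (Real.rpow_nonneg hNν.le _) hT
    hY0 hv0 hH hDV hkc hkb hWcv hWid' (hVexp Y hY0) hMVc hMVb (fun t ht => hWexp t ht v hv0) hMWc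
  -- bounds on the prefactors
  have hPb : ‖P‖ ≤ Real.log k * gB * GB := by
    have hΛ : ‖((Λ k : ℝ) : ℂ)‖ ≤ Real.log k := by
      rw [Complex.norm_real, Real.norm_eq_abs, abs_of_nonneg ArithmeticFunction.vonMangoldt_nonneg]
      exact ArithmeticFunction.vonMangoldt_le_log
    have hχ1 : ‖χ (m : ZMod q) * χ (((k : ℤ) * m + s * r : ℤ) : ZMod q)‖ ≤ 1 := by
      rw [norm_mul]
      calc ‖χ (m : ZMod q)‖ * ‖χ (((k : ℤ) * m + s * r : ℤ) : ZMod q)‖ ≤ 1 * 1 :=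
            mul_le_mul (χ.norm_le_one _) (χ.norm_le_one _) (norm_nonneg _) zero_le_one
        _ = 1 := one_mul _
    have hPk : ‖((gWeight (gapWidth c T) k / Real.sqrt k * bump ((k : ℝ) / K) ^ 2 : ℝ) : ℂ)‖ ≤ gB := by
      rw [Complex.norm_real, Real.norm_eq_abs, abs_mul, abs_div,
        abs_of_nonneg (sq_nonneg (bump ((k : ℝ) / K)))]
      have hsq : (1 : ℝ) ≤ Real.sqrt k := by
        rw [show (1 : ℝ) = Real.sqrt 1 by simp]
        exact Real.sqrt_le_sqrt (by exact_mod_cast hk)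
      have h1 : |gWeight (gapWidth c T) k| / |Real.sqrt k| ≤ gB := by
        rw [abs_of_pos (Real.sqrt_pos.mpr hk0)]
        exact (div_le_self (abs_nonneg _) hsq).trans (hg k)
      calc |gWeight (gapWidth c T) k| / |Real.sqrt k| * bump ((k : ℝ) / K) ^ 2 ≤ gB * 1 :=
            mul_le_mul h1 (bump_sq_le_one _) (sq_nonneg _) ((abs_nonneg _).trans (hg k))
        _ = gB := mul_one _
    have hPm : ‖((ρ.G q m / Real.sqrt m * bump ((m : ℝ) / M) ^ 2 : ℝ) : ℂ)‖ ≤ GB := by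
      rw [Complex.norm_real, Real.norm_eq_abs, abs_mul, abs_div,
        abs_of_nonneg (sq_nonneg (bump ((m : ℝ) / M)))]
      have hsq : (1 : ℝ) ≤ Real.sqrt m := by
        rw [show (1 : ℝ) = Real.sqrt 1 by simp]
        exact Real.sqrt_le_sqrt (by exact_mod_cast hm)
      have h1 : |ρ.G q m| / |Real.sqrt m| ≤ GB := by
        rw [abs_of_pos (Real.sqrt_pos.mpr hm0)]
        exact (div_le_self (abs_nonneg _) hsq).trans (hG m)
      calc |ρ.G q m| / |Real.sqrt m| * bump ((m : ℝ) / M) ^ 2 ≤ GB * 1 :=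
            mul_le_mul h1 (bump_sq_le_one _) (sq_nonneg _) ((abs_nonneg _).trans (hG m))
        _ = GB := mul_one _
    have hPr : ‖((bump ((r : ℝ) / R) ^ 2 : ℝ) : ℂ)‖ ≤ 1 := by
      rw [Complex.norm_real, Real.norm_eq_abs, abs_of_nonneg (sq_nonneg _)]; exact bump_sq_le_one _
    have hgB0 : 0 ≤ gB := (abs_nonneg _).trans (hg k)
    have hGB0 : 0 ≤ GB := (abs_nonneg _).trans (hG m)
    have hlog0 : 0 ≤ Real.log k := Real.log_natCast_nonneg k
    rw [hP, norm_mul, norm_mul, norm_mul, norm_mul]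
    calc ‖((Λ k : ℝ) : ℂ)‖ * ‖χ (m : ZMod q) * χ (((k : ℤ) * m + s * r : ℤ) : ZMod q)‖ *
          ‖((gWeight (gapWidth c T) k / Real.sqrt k * bump ((k : ℝ) / K) ^ 2 : ℝ) : ℂ)‖ *
          ‖((ρ.G q m / Real.sqrt m * bump ((m : ℝ) / M) ^ 2 : ℝ) : ℂ)‖ *
          ‖((bump ((r : ℝ) / R) ^ 2 : ℝ) : ℂ)‖ ≤ Real.log k * 1 * gB * GB * 1 :=
        mul_le_mul (mul_le_mul (mul_le_mul (mul_le_mul hΛ hχ1 (norm_nonneg _) hlog0) hPk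
          (norm_nonneg _) (by positivity)) hPm (norm_nonneg _) (by positivity)) hPr (norm_nonneg _)
          (by positivity)
      _ = Real.log k * gB * GB := by ring
  have hNh : Nν ^ (-(1 / 2 : ℝ)) ≤ N₀ ^ (-(1 / 2 : ℝ)) :=
    Real.rpow_le_rpow_of_nonpos hN₀ hN₀ν (by norm_num)
  have hWbB : ‖Wb‖ ≤ WB := by
    rw [hWb, Complex.norm_real, Real.norm_eq_abs, abs_mul, abs_of_nonneg (sq_nonneg (bump v))]
    calc |weightHat w B T (Real.log (1 + (s : ℝ) * u) / (2 * π))| * bump v ^ 2 ≤ WB * 1 :=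
          mul_le_mul (hWB _) (bump_sq_le_one _) (sq_nonneg _) ((abs_nonneg _).trans (hWB 0))
      _ = WB := mul_one _
  have hgB0 : 0 ≤ gB := (abs_nonneg _).trans (hg k)
  have hGB0 : 0 ≤ GB := (abs_nonneg _).trans (hG m)
  have hWB0 : 0 ≤ WB := (abs_nonneg _).trans (hWB 0)
  have hlog0 : 0 ≤ Real.log k := Real.log_natCast_nonneg k
  refine hmain.trans ?_
  have h1 : ‖P‖ * Nν ^ (-(1 / 2 : ℝ)) ≤ Real.log k * gB * GB * N₀ ^ (-(1 / 2 : ℝ)) :=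
    mul_le_mul hPb hNh (Real.rpow_nonneg hNν.le _) (by positivity)
  have h2 : τA * ‖Wb‖ + 1 / (2 * π) * (2 * H) * DV * T * τB ≤
      τA * WB + 1 / (2 * π) * (2 * H) * DV * T * τB := by
    gcongr
  exact mul_le_mul h1 h2 (by positivity) (by positivity)


/-! ### F. One box: the bound ("after integrating", TeX l.838) -/

/-- If one of the three bumps vanishes, the prefactor `P_k P_m ω(r/R)²` vanishes. [folklore] -/
private theorem prefactors_eq_zero (c : ℝ) (ρ : Resonator) (q : ℕ) (T K M R : ℝ) {k m r : ℕ}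
    (h : ¬(bump ((k : ℝ) / K) ≠ 0 ∧ bump ((m : ℝ) / M) ≠ 0 ∧ bump ((r : ℝ) / R) ≠ 0)) :
    ((gWeight (gapWidth c T) k / Real.sqrt k * bump ((k : ℝ) / K) ^ 2 : ℝ) : ℂ) *
        ((ρ.G q m / Real.sqrt m * bump ((m : ℝ) / M) ^ 2 : ℝ) : ℂ) *
        ((bump ((r : ℝ) / R) ^ 2 : ℝ) : ℂ) = 0 ∧
      bump ((k : ℝ) / K) ^ 2 * bump ((m : ℝ) / M) ^ 2 * bump ((r : ℝ) / R) ^ 2 = 0 := by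
  by_cases hk : bump ((k : ℝ) / K) = 0
  · simp [hk]
  by_cases hm : bump ((m : ℝ) / M) = 0
  · simp [hm]
  by_cases hr : bump ((r : ℝ) / R) = 0
  · simp [hr]
  exact absurd ⟨hk, hm, hr⟩ h

/-- **The box bound** ("From this it will follow, after integrating, and then summing the
`≪ (log T)^{O(1)}` partitions, that" — display — "`𝒪𝒟 ≪ q^ε T/q^η`", TeX l.838–841; this theorem
is the "after integrating" step for ONE box `(K, M, R)` and one sign `s`, in our nested-inversion
rendering): given the `n`- and `u`-partitions on the box, the
profiles `V_ν, W_μ` with their truncated expansions (tails `τ_A, τ_B`, Mellin sup-norms `D_V, D_W`),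
the separated weights `α, β, γ` through their evaluation identities, and a bound `E_B` for
`|E(K,M,R)|` uniform over the truncated square `|t|, |t'| ≤ H`, the smoothed box sum is at most
`#ν · #μ · (‖c_A‖‖c_B‖ N₀^{−1/2} T (2H/2π)² D_V D_W E_B + (Σ_k log k) ⌊2M⌋⌊2R⌋ g_B G_B N₀^{−1/2}
(τ_A W_B + (2H/2π) D_V T τ_B))`. [cite: BondarenkoHeap2026, §6.2, TeX l.825–841] -/
theorem box_bound {q : ℕ} {χ : DirichletCharacter ℂ q} (hχ : χ.IsQuadratic) (c : ℝ) (w : Bump)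
    (B : ℕ) (ρ : Resonator) {T K M R N₀ : ℝ} (hT : 0 < T) (hK : 0 < K) (hM : 0 < M) (hR : 0 < R)
    (hN₀ : 0 < N₀) {s : ℤ} (nn : ℕ → ℕ → ℕ → ℕ)
    (hnn : ∀ k ∈ Finset.Icc 1 ⌊2 * K⌋₊, ∀ m ∈ Finset.Icc 1 ⌊2 * M⌋₊, ∀ r ∈ Finset.Icc 1 ⌊2 * R⌋₊,
      bump ((k : ℝ) / K) ≠ 0 ∧ bump ((m : ℝ) / M) ≠ 0 ∧ bump ((r : ℝ) / R) ≠ 0 →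
        1 ≤ nn k m r ∧ ((nn k m r : ℕ) : ℤ) = k * m + s * r)
    (Iν Iμ : Finset ℤ) (N U : ℤ → ℝ) (hN : ∀ ν ∈ Iν, N₀ ≤ N ν) (hU : ∀ μ ∈ Iμ, 0 < U μ)
    (hpartN : ∀ k ∈ Finset.Icc 1 ⌊2 * K⌋₊, ∀ m ∈ Finset.Icc 1 ⌊2 * M⌋₊, ∀ r ∈ Finset.Icc 1 ⌊2 * R⌋₊,
      bump ((k : ℝ) / K) ≠ 0 ∧ bump ((m : ℝ) / M) ≠ 0 ∧ bump ((r : ℝ) / R) ≠ 0 →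
        ∑ ν ∈ Iν, bump ((nn k m r : ℝ) / N ν) ^ 2 = 1)
    (hpartU : ∀ k ∈ Finset.Icc 1 ⌊2 * K⌋₊, ∀ m ∈ Finset.Icc 1 ⌊2 * M⌋₊, ∀ r ∈ Finset.Icc 1 ⌊2 * R⌋₊,
      bump ((k : ℝ) / K) ≠ 0 ∧ bump ((m : ℝ) / M) ≠ 0 ∧ bump ((r : ℝ) / R) ≠ 0 →
        ∑ μ ∈ Iμ, bump ((r : ℝ) / ((k : ℝ) * m) / U μ) ^ 2 = 1)
    (V MV : ℤ → ℝ → ℂ) (W MW : ℤ → ℝ → ℝ → ℂ)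
    (hVid : ∀ ν ∈ Iν, ∀ n : ℕ, 1 ≤ n → ((ρ.G q n / Real.sqrt n * bump ((n : ℝ) / N ν) ^ 2 : ℝ) : ℂ) =
      (((N ν) ^ (-(1 / 2 : ℝ)) : ℝ) : ℂ) * V ν ((n : ℝ) / N ν))
    (hWid : ∀ μ ∈ Iμ, ∀ t u : ℝ, 0 < u → 0 < 1 + (s : ℝ) * u →
      ((weightHat w B T (Real.log (1 + (s : ℝ) * u) / (2 * π)) * bump (u / U μ) ^ 2 : ℝ) : ℂ) *
          (((1 + (s : ℝ) * u : ℝ)) : ℂ) ^ (-(t * I)) = (T : ℂ) * W μ t (u / U μ))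
    (hWc : ∀ μ ∈ Iμ, ∀ v : ℝ, Continuous fun t => W μ t v)
    {H τA τB DV DW EB gB GB WB : ℝ} (hH : 0 < H) (hτA : 0 ≤ τA) (hτB : 0 ≤ τB) (hDV : 0 ≤ DV)
    (hDW : 0 ≤ DW)
    (hVexp : ∀ ν ∈ Iν, ∀ y : ℝ, 0 < y →
      ‖V ν y - (1 / (2 * π)) • ∫ t in -H..H, MV ν t * ((y : ℝ) : ℂ) ^ (-(t * I))‖ ≤ τA)
    (hMVc : ∀ ν ∈ Iν, Continuous (MV ν)) (hMVb : ∀ ν ∈ Iν, ∀ t, ‖MV ν t‖ ≤ DV)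
    (hWexp : ∀ μ ∈ Iμ, ∀ t ∈ Set.Icc (-H) H, ∀ v : ℝ, 0 < v →
      ‖W μ t v - (1 / (2 * π)) • ∫ t' in -H..H, MW μ t t' * ((v : ℝ) : ℂ) ^ (-(t' * I))‖ ≤ τB)
    (hMWc : ∀ μ ∈ Iμ, Continuous (Function.uncurry (MW μ)))
    (hMWb : ∀ μ ∈ Iμ, ∀ t ∈ Set.Icc (-H) H, ∀ t', ‖MW μ t t'‖ ≤ DW)
    (α β γ : ℂ → ℝ → ℂ) (cA cB : ℂ)
    (hα : ∀ (z : ℂ) (k : ℕ), 1 ≤ k →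
      ((gWeight (gapWidth c T) k / Real.sqrt k * bump ((k : ℝ) / K) ^ 2 : ℝ) : ℂ) *
        ((((k : ℝ) / K : ℝ)) : ℂ) ^ (-z) = cA * α z k)
    (hβ : ∀ (z : ℂ) (m : ℕ), 1 ≤ m →
      ((ρ.G q m / Real.sqrt m * bump ((m : ℝ) / M) ^ 2 : ℝ) : ℂ) * ((((m : ℝ) / M : ℝ)) : ℂ) ^ (-z) =
        cB * β z m)
    (hγ : ∀ (z : ℂ) (r : ℕ), 1 ≤ r →
      ((bump ((r : ℝ) / R) ^ 2 : ℝ) : ℂ) * ((((r : ℝ) / R : ℝ)) : ℂ) ^ (-z) = γ z r)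
    (hE : ∀ t ∈ Set.Icc (-H) H, ∀ t' ∈ Set.Icc (-H) H,
      ‖corrSumE χ s K M R (α ((t - t') * I)) (β ((t - t') * I)) (γ (t' * I))‖ ≤ EB)
    (hg : ∀ k : ℕ, |gWeight (gapWidth c T) k| ≤ gB) (hG : ∀ n : ℕ, |ρ.G q n| ≤ GB)
    (hWB : ∀ ξ : ℝ, |weightHat w B T ξ| ≤ WB) :
    |∑ k ∈ Finset.Icc 1 ⌊2 * K⌋₊, ∑ m ∈ Finset.Icc 1 ⌊2 * M⌋₊, ∑ r ∈ Finset.Icc 1 ⌊2 * R⌋₊,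
        bump ((k : ℝ) / K) ^ 2 * bump ((m : ℝ) / M) ^ 2 * bump ((r : ℝ) / R) ^ 2 *
          jTerm c w B (ρ.coeff χ) T k m (nn k m r)| ≤
      (Iν.card : ℝ) * (Iμ.card : ℝ) *
        (‖cA‖ * ‖cB‖ * (N₀ ^ (-(1 / 2 : ℝ)) * T * (1 / (2 * π)) ^ 2) * ((2 * H) ^ 2 * (DV * DW * EB)) +
          (∑ k ∈ Finset.Icc 1 ⌊2 * K⌋₊, Real.log k) * ((⌊2 * M⌋₊ : ℝ) * (⌊2 * R⌋₊ : ℝ)) *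
            (gB * GB * N₀ ^ (-(1 / 2 : ℝ)) * (τA * WB + 1 / (2 * π) * (2 * H) * DV * T * τB))) := by
  classical
  set sK := Finset.Icc 1 ⌊2 * K⌋₊ with hsK
  set sM := Finset.Icc 1 ⌊2 * M⌋₊ with hsM
  set sR := Finset.Icc 1 ⌊2 * R⌋₊ with hsR
  -- abbreviations: prefactors, term pieces, main pieces
  set Pk : ℕ → ℂ := fun k =>
    ((gWeight (gapWidth c T) k / Real.sqrt k * bump ((k : ℝ) / K) ^ 2 : ℝ) : ℂ) with hPk
  set Pm : ℕ → ℂ := fun m => ((ρ.G q m / Real.sqrt m * bump ((m : ℝ) / M) ^ 2 : ℝ) : ℂ) with hPm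
  set Pr : ℕ → ℂ := fun r => ((bump ((r : ℝ) / R) ^ 2 : ℝ) : ℂ) with hPr
  set Wb : ℤ → ℕ → ℕ → ℕ → ℂ := fun μ k m r =>
    ((weightHat w B T (Real.log (1 + (s : ℝ) * ((r : ℝ) / ((k : ℝ) * m))) / (2 * π)) *
      bump ((r : ℝ) / ((k : ℝ) * m) / U μ) ^ 2 : ℝ) : ℂ) with hWbdef
  set tp : ℤ → ℤ → ℕ → ℕ → ℕ → ℂ := fun ν μ k m r =>
    ((Λ k : ℝ) : ℂ) * (χ (m : ZMod q) * χ (((k : ℤ) * m + s * r : ℤ) : ZMod q)) * Pk k * Pm m * Pr r *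
      (((N ν) ^ (-(1 / 2 : ℝ)) : ℝ) : ℂ) * V ν ((nn k m r : ℝ) / N ν) * Wb μ k m r with htp
  set mp : ℤ → ℤ → ℕ → ℕ → ℕ → ℂ := fun ν μ k m r =>
    ((Λ k : ℝ) : ℂ) * (χ (m : ZMod q) * χ (((k : ℤ) * m + s * r : ℤ) : ZMod q)) * Pk k * Pm m * Pr r *
      (((((N ν) ^ (-(1 / 2 : ℝ)) : ℝ)) : ℂ) * (T : ℂ) * (1 / (2 * (π : ℂ))) ^ 2) *
      ∫ t in -H..H, ∫ t' in -H..H, MV ν t * MW μ t t' *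
        (((((k : ℝ) / K : ℝ)) : ℂ) ^ (-(t * I)) * ((((m : ℝ) / M : ℝ)) : ℂ) ^ (-(t * I)) *
          (((K * M / N ν : ℝ)) : ℂ) ^ (-(t * I)) *
          ((((r : ℝ) / ((k : ℝ) * m) / U μ : ℝ)) : ℂ) ^ (-(t' * I))) with hmp
  set MAIN : ℤ → ℤ → ℂ := fun ν μ =>
    cA * cB * (((((N ν) ^ (-(1 / 2 : ℝ)) : ℝ)) : ℂ) * (T : ℂ) * (1 / (2 * (π : ℂ))) ^ 2) *
      ∫ t in -H..H, ∫ t' in -H..H, MV ν t * MW μ t t' *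
        ((((K * M / N ν : ℝ)) : ℂ) ^ (-(t * I)) * (((R / (K * M * U μ) : ℝ)) : ℂ) ^ (-(t' * I))) *
        corrSumE χ s K M R (α ((t - t') * I)) (β ((t - t') * I)) (γ (t' * I)) with hMAIN
  set e : ℕ → ℝ := fun k => Real.log k * (gB * GB * N₀ ^ (-(1 / 2 : ℝ)) *
    (τA * WB + 1 / (2 * π) * (2 * H) * DV * T * τB)) with he
  have hgB0 : 0 ≤ gB := (abs_nonneg _).trans (hg 0)
  have hGB0 : 0 ≤ GB := (abs_nonneg _).trans (hG 0)
  have hWB0 : 0 ≤ WB := (abs_nonneg _).trans (hWB 0)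
  have he0 : ∀ k, 0 ≤ e k := fun k => by
    simp only [he]
    exact mul_nonneg (Real.log_natCast_nonneg k) (by positivity)
  -- Step (i): each summand is the double sum of its pieces
  have hterm : ∀ k ∈ sK, ∀ m ∈ sM, ∀ r ∈ sR,
      ((bump ((k : ℝ) / K) ^ 2 * bump ((m : ℝ) / M) ^ 2 * bump ((r : ℝ) / R) ^ 2 *
          jTerm c w B (ρ.coeff χ) T k m (nn k m r) : ℝ) : ℂ) = ∑ ν ∈ Iν, ∑ μ ∈ Iμ, tp ν μ k m r := by
    intro k hk m hm r hr
    have hk1 : 1 ≤ k := (Finset.mem_Icc.mp hk).1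
    have hm1 : 1 ≤ m := (Finset.mem_Icc.mp hm).1
    by_cases hb : bump ((k : ℝ) / K) ≠ 0 ∧ bump ((m : ℝ) / M) ≠ 0 ∧ bump ((r : ℝ) / R) ≠ 0
    · obtain ⟨hn1, hn⟩ := hnn k hk m hm r hr hb
      exact bumps_mul_jTerm_eq_sum_pieces hχ c w B ρ T K M R hk1 hm1 hn1 hn Iν Iμ N U V
        (hpartN k hk m hm r hr hb) (hpartU k hk m hm r hr hb) (fun ν hν => hVid ν hν _ hn1)
    · obtain ⟨hP0, hb0⟩ := prefactors_eq_zero c ρ q T K M R hb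
      rw [hb0, zero_mul, Complex.ofReal_zero]
      symm
      refine Finset.sum_eq_zero fun ν _ => Finset.sum_eq_zero fun μ _ => ?_
      simp only [htp]
      have : ((Λ k : ℝ) : ℂ) * (χ (m : ZMod q) * χ (((k : ℤ) * m + s * r : ℤ) : ZMod q)) * Pk k *
          Pm m * Pr r = ((Λ k : ℝ) : ℂ) * (χ (m : ZMod q) * χ (((k : ℤ) * m + s * r : ℤ) : ZMod q)) *
          (Pk k * Pm m * Pr r) := by ring
      rw [this, hP0]; ring
  -- Step (ii): each piece is its main part up to `e k`
  have hpiece : ∀ ν ∈ Iν, ∀ μ ∈ Iμ, ∀ k ∈ sK, ∀ m ∈ sM, ∀ r ∈ sR,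
      ‖tp ν μ k m r - mp ν μ k m r‖ ≤ e k := by
    intro ν hν μ hμ k hk m hm r hr
    have hk1 : 1 ≤ k := (Finset.mem_Icc.mp hk).1
    have hm1 : 1 ≤ m := (Finset.mem_Icc.mp hm).1
    have hr1 : 1 ≤ r := (Finset.mem_Icc.mp hr).1
    have hNν : 0 < N ν := lt_of_lt_of_le hN₀ (hN ν hν)
    by_cases hb : bump ((k : ℝ) / K) ≠ 0 ∧ bump ((m : ℝ) / M) ≠ 0 ∧ bump ((r : ℝ) / R) ≠ 0
    · obtain ⟨hn1, hn⟩ := hnn k hk m hm r hr hb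
      have h := piece_diff_bound (R := R) χ c w B ρ hT hK hM hNν hN₀ (hN ν hν) (hU μ hμ) hk1 hm1 hr1
        hn1 hn
        (hWid μ hμ) (hWc μ hμ) hH hτA hτB hDV (hVexp ν hν) (hMVc ν hν) (hMVb ν hν) (hWexp μ hμ)
        (hMWc μ hμ) hg hG hWB
      simp only [htp, hmp, he]
      convert h using 1
      ring
    · obtain ⟨hP0, _⟩ := prefactors_eq_zero c ρ q T K M R hb
      have h1 : tp ν μ k m r = 0 := by
        simp only [htp]
        have : ((Λ k : ℝ) : ℂ) * (χ (m : ZMod q) * χ (((k : ℤ) * m + s * r : ℤ) : ZMod q)) * Pk k *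
            Pm m * Pr r = ((Λ k : ℝ) : ℂ) * (χ (m : ZMod q) * χ (((k : ℤ) * m + s * r : ℤ) : ZMod q)) *
            (Pk k * Pm m * Pr r) := by ring
        rw [this, hP0]; ring
      have h2 : mp ν μ k m r = 0 := by
        simp only [hmp]
        have : ((Λ k : ℝ) : ℂ) * (χ (m : ZMod q) * χ (((k : ℤ) * m + s * r : ℤ) : ZMod q)) * Pk k *
            Pm m * Pr r = ((Λ k : ℝ) : ℂ) * (χ (m : ZMod q) * χ (((k : ℤ) * m + s * r : ℤ) : ZMod q)) *
            (Pk k * Pm m * Pr r) := by ring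
        rw [this, hP0]; ring
      rw [h1, h2, sub_zero, norm_zero]
      exact he0 k
  -- Step (iii): the main parts of a piece `(ν, μ)` sum to `MAIN ν μ`
  have hmainsum : ∀ ν ∈ Iν, ∀ μ ∈ Iμ,
      ∑ k ∈ sK, ∑ m ∈ sM, ∑ r ∈ sR, mp ν μ k m r = MAIN ν μ := by
    intro ν hν μ hμ
    have hNν : 0 < N ν := lt_of_lt_of_le hN₀ (hN ν hν)
    simp only [hmp, hMAIN, hsK, hsM, hsR]
    exact sum_mainPiece_eq χ s hK hM hR hNν (hU μ hμ) T H (hMVc ν hν) (hMWc μ hμ) Pk Pm Pr α β γ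
      cA cB hα hβ hγ
  -- Step (iv): the bound for `MAIN ν μ`
  have hMAINb : ∀ ν ∈ Iν, ∀ μ ∈ Iμ, ‖MAIN ν μ‖ ≤
      ‖cA‖ * ‖cB‖ * (N₀ ^ (-(1 / 2 : ℝ)) * T * (1 / (2 * π)) ^ 2) * ((2 * H) ^ 2 * (DV * DW * EB)) := by
    intro ν hν μ hμ
    have hNν : 0 < N ν := lt_of_lt_of_le hN₀ (hN ν hν)
    have hUμ := hU μ hμ
    have hint : ‖∫ t in -H..H, ∫ t' in -H..H, MV ν t * MW μ t t' *
        ((((K * M / N ν : ℝ)) : ℂ) ^ (-(t * I)) * (((R / (K * M * U μ) : ℝ)) : ℂ) ^ (-(t' * I))) *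
        corrSumE χ s K M R (α ((t - t') * I)) (β ((t - t') * I)) (γ (t' * I))‖ ≤
        (2 * H) ^ 2 * (DV * DW * EB) := by
      refine norm_intervalIntegral₂_le hH.le fun t ht t' ht' => ?_
      rw [norm_mul, norm_mul, norm_mul, norm_mul,
        norm_ofReal_cpow_neg_mul_I (show (0 : ℝ) < K * M / N ν by positivity),
        norm_ofReal_cpow_neg_mul_I (show (0 : ℝ) < R / (K * M * U μ) by positivity), mul_one, mul_one]
      exact mul_le_mul (mul_le_mul (hMVb ν hν t) (hMWb μ hμ t ht t') (norm_nonneg _) hDV) (hE t ht t' ht')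
        (norm_nonneg _) (by positivity)
    have hconst : ‖((((N ν) ^ (-(1 / 2 : ℝ)) : ℝ)) : ℂ) * (T : ℂ) * (1 / (2 * (π : ℂ))) ^ 2‖ ≤
        N₀ ^ (-(1 / 2 : ℝ)) * T * (1 / (2 * π)) ^ 2 := by
      have hNh : (N ν) ^ (-(1 / 2 : ℝ)) ≤ N₀ ^ (-(1 / 2 : ℝ)) :=
        Real.rpow_le_rpow_of_nonpos hN₀ (hN ν hν) (by norm_num)
      rw [norm_mul, norm_mul, Complex.norm_real, Complex.norm_real, Real.norm_eq_abs, Real.norm_eq_abs,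
        abs_of_nonneg (Real.rpow_nonneg hNν.le _), abs_of_pos hT, norm_pow]
      have hπ : ‖(1 / (2 * (π : ℂ)))‖ = 1 / (2 * π) := by
        rw [norm_div, norm_one, norm_mul, Complex.norm_ofNat, Complex.norm_real, Real.norm_eq_abs,
          abs_of_pos Real.pi_pos]
      rw [hπ]
      gcongr
    simp only [hMAIN]
    rw [norm_mul, norm_mul, norm_mul]
    gcongr
  -- Step (v): assemble
  have hS : (((∑ k ∈ sK, ∑ m ∈ sM, ∑ r ∈ sR,
      bump ((k : ℝ) / K) ^ 2 * bump ((m : ℝ) / M) ^ 2 * bump ((r : ℝ) / R) ^ 2 *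
        jTerm c w B (ρ.coeff χ) T k m (nn k m r) : ℝ)) : ℂ) =
      (∑ ν ∈ Iν, ∑ μ ∈ Iμ, MAIN ν μ) +
        ∑ k ∈ sK, ∑ m ∈ sM, ∑ r ∈ sR, ∑ ν ∈ Iν, ∑ μ ∈ Iμ, (tp ν μ k m r - mp ν μ k m r) := by
    simp only [Complex.ofReal_sum]
    rw [Finset.sum_congr rfl fun k hk => Finset.sum_congr rfl fun m hm =>
      Finset.sum_congr rfl fun r hr => hterm k hk m hm r hr]
    have hsplit : ∀ ν μ k m r, tp ν μ k m r = mp ν μ k m r + (tp ν μ k m r - mp ν μ k m r) :=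
      fun _ _ _ _ _ => by ring
    conv_lhs => arg 2; ext k; arg 2; ext m; arg 2; ext r; arg 2; ext ν; arg 2; ext μ; rw [hsplit]
    simp only [Finset.sum_add_distrib]
    congr 1
    -- commute the `(k, m, r)`-sums inside the `(ν, μ)`-sums
    rw [Finset.sum_congr rfl fun k _ => Finset.sum_congr rfl fun m _ => Finset.sum_comm]
    rw [Finset.sum_congr rfl fun k _ => Finset.sum_congr rfl fun m _ =>
      Finset.sum_congr rfl fun ν _ => Finset.sum_comm]
    rw [Finset.sum_congr rfl fun k _ => Finset.sum_comm]
    rw [Finset.sum_congr rfl fun k _ => Finset.sum_congr rfl fun ν _ => Finset.sum_comm]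
    rw [Finset.sum_comm]
    rw [Finset.sum_congr rfl fun ν _ => Finset.sum_comm]
    refine Finset.sum_congr rfl fun ν hν => Finset.sum_congr rfl fun μ hμ => ?_
    exact hmainsum ν hν μ hμ
  have herr : ‖∑ k ∈ sK, ∑ m ∈ sM, ∑ r ∈ sR, ∑ ν ∈ Iν, ∑ μ ∈ Iμ, (tp ν μ k m r - mp ν μ k m r)‖ ≤
      (∑ k ∈ sK, Real.log k) * ((⌊2 * M⌋₊ : ℝ) * (⌊2 * R⌋₊ : ℝ)) * ((Iν.card : ℝ) * (Iμ.card : ℝ)) *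
        (gB * GB * N₀ ^ (-(1 / 2 : ℝ)) * (τA * WB + 1 / (2 * π) * (2 * H) * DV * T * τB)) := by
    calc ‖∑ k ∈ sK, ∑ m ∈ sM, ∑ r ∈ sR, ∑ ν ∈ Iν, ∑ μ ∈ Iμ, (tp ν μ k m r - mp ν μ k m r)‖
        ≤ ∑ k ∈ sK, ∑ m ∈ sM, ∑ r ∈ sR, ∑ ν ∈ Iν, ∑ μ ∈ Iμ, e k := by
          refine (norm_sum_le _ _).trans (Finset.sum_le_sum fun k hk => ?_)
          refine (norm_sum_le _ _).trans (Finset.sum_le_sum fun m hm => ?_)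
          refine (norm_sum_le _ _).trans (Finset.sum_le_sum fun r hr => ?_)
          refine (norm_sum_le _ _).trans (Finset.sum_le_sum fun ν hν => ?_)
          exact (norm_sum_le _ _).trans (Finset.sum_le_sum fun μ hμ => hpiece ν hν μ hμ k hk m hm r hr)
      _ = (∑ k ∈ sK, Real.log k) * ((⌊2 * M⌋₊ : ℝ) * (⌊2 * R⌋₊ : ℝ)) * ((Iν.card : ℝ) * (Iμ.card : ℝ)) *
          (gB * GB * N₀ ^ (-(1 / 2 : ℝ)) * (τA * WB + 1 / (2 * π) * (2 * H) * DV * T * τB)) := by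
          simp only [Finset.sum_const, nsmul_eq_mul, he, hsM, hsR, Nat.card_Icc, Finset.sum_mul]
          refine Finset.sum_congr rfl fun k _ => ?_
          push_cast
          ring
  have hmain : ‖∑ ν ∈ Iν, ∑ μ ∈ Iμ, MAIN ν μ‖ ≤ ((Iν.card : ℝ) * (Iμ.card : ℝ)) *
      (‖cA‖ * ‖cB‖ * (N₀ ^ (-(1 / 2 : ℝ)) * T * (1 / (2 * π)) ^ 2) * ((2 * H) ^ 2 * (DV * DW * EB))) := by
    calc ‖∑ ν ∈ Iν, ∑ μ ∈ Iμ, MAIN ν μ‖ ≤ ∑ ν ∈ Iν, ∑ μ ∈ Iμ,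
        ‖cA‖ * ‖cB‖ * (N₀ ^ (-(1 / 2 : ℝ)) * T * (1 / (2 * π)) ^ 2) * ((2 * H) ^ 2 * (DV * DW * EB)) :=
          (norm_sum_le _ _).trans (Finset.sum_le_sum fun ν hν =>
            (norm_sum_le _ _).trans (Finset.sum_le_sum fun μ hμ => hMAINb ν hν μ hμ))
      _ = _ := by simp only [Finset.sum_const, nsmul_eq_mul]; ring
  rw [← Real.norm_eq_abs, ← Complex.norm_real, hS]
  refine (norm_add_le _ _).trans ?_
  have htot := add_le_add hmain herr
  refine htot.trans (le_of_eq ?_)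
  ring


/-! ### G. Bricks for the instantiation: elementary bounds and the negative-shift box -/

/-- **`|g_h(k)| ≤ 2`** for every natural `k` and every `h` (`g_h(k) = sin(½ h log k)/log k`; for
`k ≤ 1` the value is `0` by the conventions `log 0 = log 1 = 0`, `x/0 = 0`; for `k ≥ 2`,
`|g_h(k)| ≤ 1/log 2 < 2`). [cite: BondarenkoHeap2026, Proposition 1 p. 7 (g_h)] -/
theorem abs_gWeight_le_two (h : ℝ) (k : ℕ) : |gWeight h k| ≤ 2 := by
  unfold gWeight
  rcases Nat.lt_or_ge k 2 with hk | hk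
  · interval_cases k <;> simp
  · have hk2 : (2 : ℝ) ≤ k := by exact_mod_cast hk
    have hlog : Real.log 2 ≤ Real.log k := Real.log_le_log two_pos hk2
    have hlog2 : (1 / 2 : ℝ) < Real.log 2 := by
      have := Real.log_two_gt_d9; linarith
    have hlogk : 0 < Real.log k := by linarith
    rw [abs_div, abs_of_pos hlogk, div_le_iff₀ hlogk]
    calc |Real.sin (h * Real.log k / 2)| ≤ 1 := Real.abs_sin_le_one _
      _ ≤ 2 * Real.log k := by linarith

/-- **Monotonicity of the corrected weight class in the derivative family**: `A ≤ A'` pointwise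
(and `Q ≥ 0`, `X > 0`) lets an `IsSmoothDyadicWeight' X A Q` weight pass to `A'`.
[cite: BondarenkoHeap2026, §6.2, TeX l.831] -/
theorem isSmoothDyadicWeight'_mono_family {X : ℝ} {A A' : ℕ → ℝ} {Q : ℝ} {a : ℝ → ℂ}
    (h : IsSmoothDyadicWeight' X A Q a) (hX : 0 < X) (hQ : 0 ≤ Q) (hAA' : ∀ j, A j ≤ A' j) :
    IsSmoothDyadicWeight' X A' Q a := by
  refine ⟨h.1, h.2.1, h.2.2.1, fun j x => (h.2.2.2 j x).trans ?_⟩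
  exact div_le_div_of_nonneg_right (mul_le_mul_of_nonneg_right (hAA' j) (pow_nonneg hQ j))
    (pow_pos hX j).le

/-- **The negative-shift box as a plain smoothed sum**: if on the support of the three bumps one
always has `r < km` (true on admissible boxes once `T` exceeds twice the implied constant, since
`r ≤ 2R ≤ 2C₀KM/T < KM ≤ km`), then
`odBoxNeg = Σ ω(k/K)² ω(m/M)² ω(r/R)² · jTerm(k, m, km − r)` with natural subtraction.
[cite: BondarenkoHeap2026, §6.2, TeX l.750] -/
theorem odBoxNeg_eq_sum_of_lt (c : ℝ) (w : Bump) (B : ℕ) (ρ : Resonator) {q : ℕ}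
    (χ : DirichletCharacter ℂ q) (K M R : ℝ)
    (hlt : ∀ k ∈ Finset.Icc 1 ⌊2 * K⌋₊, ∀ m ∈ Finset.Icc 1 ⌊2 * M⌋₊, ∀ r ∈ Finset.Icc 1 ⌊2 * R⌋₊,
      bump ((k : ℝ) / K) ≠ 0 ∧ bump ((m : ℝ) / M) ≠ 0 ∧ bump ((r : ℝ) / R) ≠ 0 → r < k * m) :
    odBoxNeg c w B ρ χ K M R =
      ∑ k ∈ Finset.Icc 1 ⌊2 * K⌋₊, ∑ m ∈ Finset.Icc 1 ⌊2 * M⌋₊, ∑ r ∈ Finset.Icc 1 ⌊2 * R⌋₊,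
        bump ((k : ℝ) / K) ^ 2 * bump ((m : ℝ) / M) ^ 2 * bump ((r : ℝ) / R) ^ 2 *
          jTerm c w B (ρ.coeff χ) (ρ.T q) k m (k * m - r) := by
  unfold odBoxNeg
  refine Finset.sum_congr rfl fun k hk => Finset.sum_congr rfl fun m hm =>
    Finset.sum_congr rfl fun r hr => ?_
  by_cases hb : bump ((k : ℝ) / K) ≠ 0 ∧ bump ((m : ℝ) / M) ≠ 0 ∧ bump ((r : ℝ) / R) ≠ 0
  · rw [if_pos (hlt k hk m hm r hr hb)]
  · obtain ⟨_, h0⟩ := prefactors_eq_zero c ρ q (ρ.T q) K M R hb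
    rw [h0, zero_mul, zero_mul]

/-- **Support bookkeeping for one summand**: if the three bumps are non-zero then `K ≤ k ≤ 2K`,
`M ≤ m ≤ 2M`, `R ≤ r ≤ 2R` (`bump_div_ne_zero_imp`), hence `KM ≤ km ≤ 4KM` and, for
`n = km + s r` with `2R ≤ KM/4`, `(3/4)·KM ≤ n ≤ (17/4)·KM`; and `u = r/(km) ∈ [R/(4KM), 2R/(KM)]`.
[cite: BondarenkoHeap2026, §6.2, TeX l.765–769] -/
theorem support_bounds {K M R : ℝ} (hK : 0 < K) (hM : 0 < M) (hR : 0 < R) {k m r : ℕ}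
    (hb : bump ((k : ℝ) / K) ≠ 0 ∧ bump ((m : ℝ) / M) ≠ 0 ∧ bump ((r : ℝ) / R) ≠ 0) :
    (K ≤ k ∧ (k : ℝ) ≤ 2 * K) ∧ (M ≤ m ∧ (m : ℝ) ≤ 2 * M) ∧ (R ≤ r ∧ (r : ℝ) ≤ 2 * R) ∧
      (K * M ≤ (k : ℝ) * m ∧ (k : ℝ) * m ≤ 4 * (K * M)) ∧
      (R / (4 * (K * M)) ≤ (r : ℝ) / ((k : ℝ) * m) ∧ (r : ℝ) / ((k : ℝ) * m) ≤ 2 * R / (K * M)) := by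
  obtain ⟨hk, hm, hr⟩ := hb
  have h1 := SmoothDyadicPartition.bump_div_ne_zero_imp hK hk
  have h2 := SmoothDyadicPartition.bump_div_ne_zero_imp hM hm
  have h3 := SmoothDyadicPartition.bump_div_ne_zero_imp hR hr
  have hKM : K * M ≤ (k : ℝ) * m := mul_le_mul h1.1 h2.1 hM.le (hK.le.trans h1.1)
  have hKM' : (k : ℝ) * m ≤ 4 * (K * M) := by
    calc (k : ℝ) * m ≤ (2 * K) * (2 * M) := mul_le_mul h1.2 h2.2 (hM.le.trans h2.1) (by positivity)
      _ = 4 * (K * M) := by ring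
  have hkm0 : 0 < (k : ℝ) * m := lt_of_lt_of_le (mul_pos hK hM) hKM
  refine ⟨h1, h2, h3, ⟨hKM, hKM'⟩, ?_, ?_⟩
  · rw [div_le_div_iff₀ (by positivity) hkm0]
    calc R * ((k : ℝ) * m) ≤ R * (4 * (K * M)) := mul_le_mul_of_nonneg_left hKM' hR.le
      _ ≤ r * (4 * (K * M)) := mul_le_mul_of_nonneg_right h3.1 (by positivity)
  · rw [div_le_div_iff₀ hkm0 (by positivity)]
    calc (r : ℝ) * (K * M) ≤ (2 * R) * (K * M) := mul_le_mul_of_nonneg_right h3.2 (by positivity)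
      _ ≤ (2 * R) * ((k : ℝ) * m) := mul_le_mul_of_nonneg_left hKM (by positivity)
      _ = 2 * R * ((k : ℝ) * m) := by ring


/-! ### H. One admissible box at the scales of `offDiagOD_eq_sum_boxes`: both signs -/

/-- `√2^(a) * √2^(b) = √2^(a+b)` and friends are used through `zpow_add₀`; here: the box scales.
[folklore] -/
private theorem sqrt_two_zpow_pos (z : ℤ) : 0 < Real.sqrt 2 ^ z :=
  zpow_pos (Real.sqrt_pos.mpr two_pos) z

/-- `√2^2 = 2`, `√2^4 = 4` as `zpow`. [folklore] -/
private theorem sqrt_two_zpow_two : Real.sqrt 2 ^ (2 : ℤ) = 2 := by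
  rw [zpow_ofNat, Real.sq_sqrt (by norm_num)]

/-- The `√2`-adic window containing a real `x` with `A ≤ x ≤ A · √2^w` for `A = √2^a`:
`√2^{a} ≤ x ≤ √2^{a+w}` gives the partition identity on `Icc (a-1) (a+w-1)`. [folklore] -/
private theorem sum_bump_sq_window {x : ℝ} {a : ℤ} {wd : ℕ} (hlo : Real.sqrt 2 ^ a ≤ x)
    (hhi : x ≤ Real.sqrt 2 ^ (a + wd)) :
    ∑ ν ∈ Finset.Icc (a - 1) (a + wd - 1), bump (x / Real.sqrt 2 ^ ν) ^ 2 = 1 := by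
  refine SmoothDyadicPartition.sum_bump_sq_eq_one (a := a - 1) (b := a + wd - 1) ?_ ?_
  · rwa [sub_add_cancel]
  · rwa [sub_add_cancel]


set_option maxHeartbeats 800000 in
/-- **Both signs on one admissible box** at `√2`-adic scales `K = √2^κ`, `M = √2^μ`, `R = √2^λ`
(the boxes of `offDiagOD_eq_sum_boxes`, `κ = i − 1` etc.): with the `n`-window
`N ∈ {√2^ν : κ+μ−2 ≤ ν ≤ κ+μ+4}` (so `KM/2 ≤ N ≤ 4KM`) and the `u`-window
`U ∈ {√2^ν : e−5 ≤ ν ≤ e+1}`, `e = λ−κ−μ` (so `U ≤ √2 R/(KM) ≤ √2 C₀/T`), the profiles at this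
`q` (`V N`, `W U s t`), their truncated expansions with tails `τ_A, τ_B` and Mellin sup-norms
`D_V, D_W`, the weights `α, β` through their evaluation identities and `γ = ω(x/R)²(x/R)^{−z}`, and
a bound `EB` for `‖E(K,M,R)‖` on `|t|,|t'| ≤ H` for both signs, one gets
`|odBoxPos| + |odBoxNeg| ≤ 2 · 7 · 7 · (MAIN + ERR)` with the constants of `box_bound` at
`N₀ = KM/2`, `g_B = 2`. [cite: BondarenkoHeap2026, §6.2, TeX l.750–751 and l.825–841] -/
theorem admissible_box_bound {q : ℕ} {χ : DirichletCharacter ℂ q} (hχ : χ.IsQuadratic) (c : ℝ)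
    (w : Bump) (B : ℕ) (ρ : Resonator) {C₀ : ℝ} (hC₀ : 1 ≤ C₀) (hT8 : 8 * C₀ ≤ ρ.T q)
    {κ μ lam : ℤ} {K M R : ℝ} (hKdef : K = Real.sqrt 2 ^ κ) (hMdef : M = Real.sqrt 2 ^ μ)
    (hRdef : R = Real.sqrt 2 ^ lam) (hKM1 : 1 ≤ K * M)
    (hadm : IsAdmissibleScale' q ρ.δ C₀ K M R)
    (V : ℝ → ℝ → ℂ) (W : ℝ → ℤ → ℝ → ℝ → ℂ)
    (hVid : ∀ (N : ℝ) (n : ℕ), 1 ≤ n → 0 < N →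
      ((ρ.G q n / Real.sqrt n * bump ((n : ℝ) / N) ^ 2 : ℝ) : ℂ) =
        (((N ^ (-(1 / 2 : ℝ)) : ℝ)) : ℂ) * V N ((n : ℝ) / N))
    (hWid : ∀ (U : ℝ) (s : ℤ) (t u : ℝ), 0 < U → 0 < u → 0 < 1 + (s : ℝ) * u →
      ((weightHat w B (ρ.T q) (Real.log (1 + (s : ℝ) * u) / (2 * π)) * bump (u / U) ^ 2 : ℝ) : ℂ) *
          (((1 + (s : ℝ) * u : ℝ)) : ℂ) ^ (-(t * I)) = (ρ.T q : ℂ) * W U s t (u / U))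
    (hWc : ∀ (U : ℝ) (s : ℤ) (v : ℝ), 0 < U → U ≤ 1 / 4 → (s = 1 ∨ s = -1) →
      Continuous fun t => W U s t v)
    {H DV DW τA τB : ℝ} (hH : 1 ≤ H) (hHT : H ≤ ρ.T q) (hDV : 0 ≤ DV) (hDW : 0 ≤ DW)
    (hτA : 0 ≤ τA) (hτB : 0 ≤ τB)
    (hVc : ∀ N : ℝ, 0 < N → Continuous (V N) ∧ ∀ y, V N y ≠ 0 → 1 ≤ y ∧ y ≤ 2)
    (hVdec : ∀ N : ℝ, 2⁻¹ ≤ N → N ≤ 4 * C₀ * lengthL q →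
      (∀ t : ℝ, ‖mellin (V N) (t * I)‖ ≤ DV) ∧
        ∀ y : ℝ, 0 < y → ‖V N y - (1 / (2 * π)) • ∫ t in -H..H,
          mellin (V N) (t * I) * ((y : ℝ) : ℂ) ^ (-(t * I))‖ ≤ τA)
    (hWdec : ∀ U : ℝ, 0 < U → U ≤ 1 / 4 → U * ρ.T q ≤ 2 * C₀ → ∀ s : ℤ, (s = 1 ∨ s = -1) →
      ∀ t : ℝ, U * |t| ≤ 2 * C₀ →
        (∀ t' : ℝ, ‖mellin (W U s t) (t' * I)‖ ≤ DW) ∧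
          ∀ v : ℝ, 0 < v → ‖W U s t v - (1 / (2 * π)) • ∫ t' in -H..H,
            mellin (W U s t) (t' * I) * ((v : ℝ) : ℂ) ^ (-(t' * I))‖ ≤ τB)
    (hWcont : ∀ (U : ℝ) (s : ℤ), 0 < U → U ≤ 1 / 4 → (s = 1 ∨ s = -1) →
      Continuous fun p : ℝ × ℝ => mellin (W U s p.1) (p.2 * I))
    (α β : ℂ → ℝ → ℂ) {cA cB : ℝ} (hcA : 0 ≤ cA) (hcB : 0 ≤ cB)
    (hα : ∀ (z : ℂ) (k : ℕ), 1 ≤ k →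
      ((gWeight (gapWidth c (ρ.T q)) k / Real.sqrt k * bump ((k : ℝ) / K) ^ 2 : ℝ) : ℂ) *
        ((((k : ℝ) / K : ℝ)) : ℂ) ^ (-z) = (((cA * K ^ (-(1 / 2 : ℝ)) : ℝ)) : ℂ) * α z k)
    (hβ : ∀ (z : ℂ) (m : ℕ), 1 ≤ m →
      ((ρ.G q m / Real.sqrt m * bump ((m : ℝ) / M) ^ 2 : ℝ) : ℂ) * ((((m : ℝ) / M : ℝ)) : ℂ) ^ (-z) =
        (((cB * M ^ (-(1 / 2 : ℝ)) : ℝ)) : ℂ) * β z m)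
    {EB : ℝ}
    (hE : ∀ s : ℤ, (s = 1 ∨ s = -1) → ∀ t ∈ Set.Icc (-H) H, ∀ t' ∈ Set.Icc (-H) H,
      ‖corrSumE χ s K M R (α ((t - t') * I)) (β ((t - t') * I))
        (fun x : ℝ => ((bump (x / R) ^ 2 : ℝ) : ℂ) * (((x / R : ℝ)) : ℂ) ^ (-(t' * I)))‖ ≤ EB)
    {GB WB : ℝ} (hG : ∀ n : ℕ, |ρ.G q n| ≤ GB) (hWB : ∀ ξ : ℝ, |weightHat w B (ρ.T q) ξ| ≤ WB) :
    |odBoxPos c w B ρ χ K M R| + |odBoxNeg c w B ρ χ K M R| ≤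
      2 * ((7 : ℝ) * 7 *
        ((cA * K ^ (-(1 / 2 : ℝ))) * (cB * M ^ (-(1 / 2 : ℝ))) *
            ((K * M / 2) ^ (-(1 / 2 : ℝ)) * ρ.T q * (1 / (2 * π)) ^ 2) * ((2 * H) ^ 2 * (DV * DW * EB)) +
          (∑ k ∈ Finset.Icc 1 ⌊2 * K⌋₊, Real.log k) * ((⌊2 * M⌋₊ : ℝ) * (⌊2 * R⌋₊ : ℝ)) *
            (2 * GB * (K * M / 2) ^ (-(1 / 2 : ℝ)) *
              (τA * WB + 1 / (2 * π) * (2 * H) * DV * ρ.T q * τB)))) := by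
  -- positivity of the scales and the basic inequalities of the box
  have hs2 : (1 : ℝ) < Real.sqrt 2 := Real.one_lt_sqrt_two
  have hs0 : (0 : ℝ) < Real.sqrt 2 := by linarith
  have hsq2 : Real.sqrt 2 ^ (2 : ℤ) = 2 := sqrt_two_zpow_two
  have hK0 : 0 < K := by rw [hKdef]; exact zpow_pos hs0 _
  have hM0 : 0 < M := by rw [hMdef]; exact zpow_pos hs0 _
  have hR0 : 0 < R := by rw [hRdef]; exact zpow_pos hs0 _
  have hT0 : 0 < ρ.T q := by linarith
  have hKM0 : 0 < K * M := mul_pos hK0 hM0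
  have hRKM : R ≤ C₀ * (K * M) / ρ.T q := by
    have h := hadm.2.2.2.1; simp only [Resonator.T]; exact h
  have hKML : K * M ≤ C₀ * lengthL q := by
    have h := hadm.2.2.2.2; simp only [lengthL]; exact h
  -- `2R ≤ KM/4`
  have h2R : 2 * R ≤ K * M / 4 := by
    have h1 : R * ρ.T q ≤ C₀ * (K * M) := by rwa [le_div_iff₀ hT0] at hRKM
    nlinarith
  -- the window exponents
  have hKM : K * M = Real.sqrt 2 ^ (κ + μ) := by rw [hKdef, hMdef, zpow_add₀ hs0.ne']
  have hN₀ : K * M / 2 = Real.sqrt 2 ^ (κ + μ - 2) := by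
    rw [zpow_sub₀ hs0.ne', hsq2, hKM]
  have hRKMe : R / (K * M) = Real.sqrt 2 ^ (lam - (κ + μ)) := by
    rw [zpow_sub₀ hs0.ne', hKM, hRdef]
  set Iν : Finset ℤ := Finset.Icc (κ + μ - 1 - 1) (κ + μ - 1 + 6 - 1) with hIν
  set Iμ : Finset ℤ := Finset.Icc (lam - (κ + μ) - 4 - 1) (lam - (κ + μ) - 4 + 6 - 1) with hIμ
  have hcardν : Iν.card = 7 := by
    rw [hIν, Int.card_Icc, show κ + μ - 1 + 6 - 1 + 1 - (κ + μ - 1 - 1) = 7 by ring]; rfl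
  have hcardμ : Iμ.card = 7 := by
    rw [hIμ, Int.card_Icc,
      show lam - (κ + μ) - 4 + 6 - 1 + 1 - (lam - (κ + μ) - 4 - 1) = 7 by ring]; rfl
  set N : ℤ → ℝ := fun ν => Real.sqrt 2 ^ ν with hNdef
  -- `N ν ≥ KM/2` and `N ν ≤ 4 KM` on the window
  have hNlow : ∀ ν ∈ Iν, K * M / 2 ≤ N ν := by
    intro ν hν
    have h := (Finset.mem_Icc.mp hν).1
    rw [hN₀, hNdef]
    exact zpow_le_zpow_right₀ hs2.le (by omega)
  have hNhigh : ∀ ν ∈ Iν, N ν ≤ 4 * C₀ * lengthL q := by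
    intro ν hν
    have h := (Finset.mem_Icc.mp hν).2
    have h4 : N ν ≤ Real.sqrt 2 ^ (κ + μ + 4) := zpow_le_zpow_right₀ hs2.le (by omega)
    have h44 : Real.sqrt 2 ^ (κ + μ + 4) = 4 * (K * M) := by
      rw [zpow_add₀ hs0.ne', ← hKM, show (4 : ℤ) = 2 + 2 by norm_num, zpow_add₀ hs0.ne', hsq2]; ring
    rw [h44] at h4
    nlinarith
  have hNpos : ∀ ν ∈ Iν, 0 < N ν := fun ν _ => zpow_pos hs0 _
  have hNhalf : ∀ ν ∈ Iν, 2⁻¹ ≤ N ν := fun ν hν => by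
    have := hNlow ν hν; nlinarith
  -- `U μ ≤ √2 R/(KM)` on the `u`-window, hence `U ≤ 1/4`, `U T ≤ 2C₀`
  have hUpos : ∀ ν ∈ Iμ, 0 < N ν := fun ν _ => zpow_pos hs0 _
  have hUle : ∀ ν ∈ Iμ, N ν ≤ Real.sqrt 2 * (R / (K * M)) := by
    intro ν hν
    have h := (Finset.mem_Icc.mp hν).2
    have h1 : N ν ≤ Real.sqrt 2 ^ (lam - (κ + μ) + 1) := zpow_le_zpow_right₀ hs2.le (by omega)
    rw [zpow_add₀ hs0.ne', zpow_one, ← hRKMe] at h1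
    linarith [h1]
  have hRKMT : R / (K * M) ≤ C₀ / ρ.T q := by
    rw [div_le_div_iff₀ hKM0 hT0]
    have h1 : R * ρ.T q ≤ C₀ * (K * M) := by rwa [le_div_iff₀ hT0] at hRKM
    linarith
  have hs2le : Real.sqrt 2 ≤ 2 := by
    have := Real.sqrt_le_sqrt (show (2 : ℝ) ≤ 4 by norm_num)
    rwa [show (4 : ℝ) = 2 ^ 2 by norm_num, Real.sqrt_sq (by norm_num)] at this
  have hUle' : ∀ ν ∈ Iμ, N ν ≤ 2 * C₀ / ρ.T q := fun ν hν => (hUle ν hν).trans (by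
    calc Real.sqrt 2 * (R / (K * M)) ≤ 2 * (C₀ / ρ.T q) :=
          mul_le_mul hs2le hRKMT (div_nonneg hR0.le hKM0.le) (by norm_num)
      _ = 2 * C₀ / ρ.T q := by ring)
  have hUT : ∀ ν ∈ Iμ, N ν * ρ.T q ≤ 2 * C₀ := fun ν hν => by
    have h := hUle' ν hν; rwa [le_div_iff₀ hT0] at h
  have hU4 : ∀ ν ∈ Iμ, N ν ≤ 1 / 4 := fun ν hν => (hUle' ν hν).trans (by
    rw [div_le_iff₀ hT0]; linarith)
  have hN₀pos : 0 < K * M / 2 := by positivity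
  have hH0 : 0 < H := by linarith
  -- numeric facts about `√2`
  have hs2ge : (7 / 5 : ℝ) ≤ Real.sqrt 2 := by
    rw [show (7 / 5 : ℝ) = Real.sqrt ((7 / 5) ^ 2) by rw [Real.sqrt_sq (by norm_num)]]
    exact Real.sqrt_le_sqrt (by norm_num)
  have hs4 : Real.sqrt 2 ^ (4 : ℤ) = 4 := by
    rw [show (4 : ℤ) = 2 + 2 by norm_num, zpow_add₀ hs0.ne', hsq2]; norm_num
  have hs5 : Real.sqrt 2 ^ (5 : ℤ) = 4 * Real.sqrt 2 := by
    rw [show (5 : ℤ) = 4 + 1 by norm_num, zpow_add₀ hs0.ne', hs4, zpow_one]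
  -- the partition identities on the support
  have hpartN : ∀ (s : ℤ), (s = 1 ∨ s = -1) → ∀ (nn : ℕ → ℕ → ℕ → ℕ),
      ∀ k ∈ Finset.Icc 1 ⌊2 * K⌋₊, ∀ m ∈ Finset.Icc 1 ⌊2 * M⌋₊, ∀ r ∈ Finset.Icc 1 ⌊2 * R⌋₊,
      (bump ((k : ℝ) / K) ≠ 0 ∧ bump ((m : ℝ) / M) ≠ 0 ∧ bump ((r : ℝ) / R) ≠ 0 →
        1 ≤ nn k m r ∧ ((nn k m r : ℕ) : ℤ) = k * m + s * r) →
      bump ((k : ℝ) / K) ≠ 0 ∧ bump ((m : ℝ) / M) ≠ 0 ∧ bump ((r : ℝ) / R) ≠ 0 →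
        ∑ ν ∈ Iν, bump ((nn k m r : ℝ) / N ν) ^ 2 = 1 := by
    intro s hs nn k hk m hm r hr hnn hb
    obtain ⟨_, _, h3, h4, _⟩ := support_bounds hK0 hM0 hR0 hb
    obtain ⟨_, hn⟩ := hnn hb
    have hnr : ((nn k m r : ℕ) : ℝ) = (k : ℝ) * m + (s : ℝ) * r := by exact_mod_cast hn
    have hsr : -(r : ℝ) ≤ (s : ℝ) * r ∧ (s : ℝ) * r ≤ r := by
      rcases hs with rfl | rfl <;> simp
    have hr0 : (0 : ℝ) ≤ r := Nat.cast_nonneg r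
    have hlo : Real.sqrt 2 ^ (κ + μ - 1) ≤ (nn k m r : ℝ) := by
      rw [zpow_sub₀ hs0.ne', zpow_one, ← hKM, hnr, div_le_iff₀ hs0]
      have h6 : 3 / 4 * (K * M) ≤ (k : ℝ) * m + (s : ℝ) * r := by linarith [h4.1, h3.2, hsr.1]
      have h7 : 3 / 4 * (K * M) * (7 / 5) ≤ ((k : ℝ) * m + (s : ℝ) * r) * Real.sqrt 2 :=
        mul_le_mul h6 hs2ge (by norm_num) (by linarith)
      linarith
    have hhi : ((nn k m r : ℕ) : ℝ) ≤ Real.sqrt 2 ^ (κ + μ - 1 + (6 : ℕ)) := by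
      rw [show κ + μ - 1 + ((6 : ℕ) : ℤ) = κ + μ + 5 by push_cast; ring, zpow_add₀ hs0.ne', ← hKM,
        hs5, hnr]
      have h6 : (k : ℝ) * m + (s : ℝ) * r ≤ (17 / 4) * (K * M) := by linarith [h4.2, h3.2, hsr.2]
      have h7 : K * M * (4 * (7 / 5)) ≤ K * M * (4 * Real.sqrt 2) :=
        mul_le_mul_of_nonneg_left (by linarith) hKM0.le
      linarith
    exact sum_bump_sq_window hlo hhi
  have hpartU : ∀ k ∈ Finset.Icc 1 ⌊2 * K⌋₊, ∀ m ∈ Finset.Icc 1 ⌊2 * M⌋₊,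
      ∀ r ∈ Finset.Icc 1 ⌊2 * R⌋₊,
      bump ((k : ℝ) / K) ≠ 0 ∧ bump ((m : ℝ) / M) ≠ 0 ∧ bump ((r : ℝ) / R) ≠ 0 →
        ∑ ν ∈ Iμ, bump ((r : ℝ) / ((k : ℝ) * m) / N ν) ^ 2 = 1 := by
    intro k hk m hm r hr hb
    obtain ⟨_, _, _, _, h5⟩ := support_bounds hK0 hM0 hR0 hb
    have hlo : Real.sqrt 2 ^ (lam - (κ + μ) - 4) ≤ (r : ℝ) / ((k : ℝ) * m) := by
      rw [zpow_sub₀ hs0.ne', hs4, ← hRKMe]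
      have : R / (K * M) / 4 = R / (4 * (K * M)) := by field_simp
      rw [this]; exact h5.1
    have hhi : (r : ℝ) / ((k : ℝ) * m) ≤ Real.sqrt 2 ^ (lam - (κ + μ) - 4 + (6 : ℕ)) := by
      rw [show lam - (κ + μ) - 4 + ((6 : ℕ) : ℤ) = lam - (κ + μ) + 2 by push_cast; ring,
        zpow_add₀ hs0.ne', hsq2, ← hRKMe]
      have : R / (K * M) * 2 = 2 * R / (K * M) := by ring
      rw [this]; exact h5.2
    exact sum_bump_sq_window hlo hhi
  -- the box bound for one sign
  have hbox : ∀ (s : ℤ), (s = 1 ∨ s = -1) → ∀ (nn : ℕ → ℕ → ℕ → ℕ),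
      (∀ k ∈ Finset.Icc 1 ⌊2 * K⌋₊, ∀ m ∈ Finset.Icc 1 ⌊2 * M⌋₊, ∀ r ∈ Finset.Icc 1 ⌊2 * R⌋₊,
        bump ((k : ℝ) / K) ≠ 0 ∧ bump ((m : ℝ) / M) ≠ 0 ∧ bump ((r : ℝ) / R) ≠ 0 →
          1 ≤ nn k m r ∧ ((nn k m r : ℕ) : ℤ) = k * m + s * r) →
      |∑ k ∈ Finset.Icc 1 ⌊2 * K⌋₊, ∑ m ∈ Finset.Icc 1 ⌊2 * M⌋₊, ∑ r ∈ Finset.Icc 1 ⌊2 * R⌋₊,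
          bump ((k : ℝ) / K) ^ 2 * bump ((m : ℝ) / M) ^ 2 * bump ((r : ℝ) / R) ^ 2 *
            jTerm c w B (ρ.coeff χ) (ρ.T q) k m (nn k m r)| ≤
        (7 : ℝ) * 7 *
          ((cA * K ^ (-(1 / 2 : ℝ))) * (cB * M ^ (-(1 / 2 : ℝ))) *
              ((K * M / 2) ^ (-(1 / 2 : ℝ)) * ρ.T q * (1 / (2 * π)) ^ 2) * ((2 * H) ^ 2 * (DV * DW * EB)) +
            (∑ k ∈ Finset.Icc 1 ⌊2 * K⌋₊, Real.log k) * ((⌊2 * M⌋₊ : ℝ) * (⌊2 * R⌋₊ : ℝ)) *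
              (2 * GB * (K * M / 2) ^ (-(1 / 2 : ℝ)) *
                (τA * WB + 1 / (2 * π) * (2 * H) * DV * ρ.T q * τB))) := by
    intro s hs nn hnn
    have hMVc : ∀ ν ∈ Iν, Continuous fun t : ℝ => mellin (V (N ν)) (t * I) := by
      intro ν hν
      have h := MellinTruncated.continuous_mellin_vertical (hVc (N ν) (hNpos ν hν)).1
        (hVc (N ν) (hNpos ν hν)).2 0
      simpa using h
    have h := box_bound hχ c w B ρ hT0 hK0 hM0 hR0 hN₀pos nn hnn Iν Iμ N N hNlow hUpos
      (fun k hk m hm r hr hb => hpartN s hs nn k hk m hm r hr (hnn k hk m hm r hr) hb) hpartU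
      (fun ν => V (N ν)) (fun ν t => mellin (V (N ν)) (t * I))
      (fun ν t v => W (N ν) s t v) (fun ν t t' => mellin (W (N ν) s t) (t' * I))
      (fun ν hν n hn => hVid (N ν) n hn (hNpos ν hν))
      (fun ν hν t u hu h1 => hWid (N ν) s t u (hUpos ν hν) hu h1)
      (fun ν hν v => hWc (N ν) s v (hUpos ν hν) (hU4 ν hν) hs) hH0 hτA hτB hDV hDW
      (fun ν hν => (hVdec (N ν) (hNhalf ν hν) (hNhigh ν hν)).2) hMVc
      (fun ν hν t => (hVdec (N ν) (hNhalf ν hν) (hNhigh ν hν)).1 t)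
      (fun ν hν t ht v hv => (hWdec (N ν) (hUpos ν hν) (hU4 ν hν) (hUT ν hν) s hs t ?_).2 v hv)
      (fun ν hν => hWcont (N ν) s (hUpos ν hν) (hU4 ν hν) hs)
      (fun ν hν t ht t' => (hWdec (N ν) (hUpos ν hν) (hU4 ν hν) (hUT ν hν) s hs t ?_).1 t')
      α β (fun z x => ((bump (x / R) ^ 2 : ℝ) : ℂ) * (((x / R : ℝ)) : ℂ) ^ (-z))
      (((cA * K ^ (-(1 / 2 : ℝ)) : ℝ) : ℂ)) (((cB * M ^ (-(1 / 2 : ℝ)) : ℝ) : ℂ)) hα hβ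
      (fun z r _ => rfl) (hE s hs) (abs_gWeight_le_two _) hG hWB
    rotate_left
    · -- `U |t| ≤ U T ≤ 2 C₀` for `|t| ≤ H ≤ T`
      have habs : |t| ≤ ρ.T q := (abs_le.mpr ⟨by linarith [ht.1], ht.2⟩).trans hHT
      exact (mul_le_mul_of_nonneg_left habs (hUpos ν hν).le).trans (hUT ν hν)
    · have habs : |t| ≤ ρ.T q := (abs_le.mpr ⟨by linarith [ht.1], ht.2⟩).trans hHT
      exact (mul_le_mul_of_nonneg_left habs (hUpos ν hν).le).trans (hUT ν hν)
    rw [hcardν, hcardμ] at h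
    have hcA' : ‖(((cA * K ^ (-(1 / 2 : ℝ)) : ℝ)) : ℂ)‖ = cA * K ^ (-(1 / 2 : ℝ)) := by
      rw [Complex.norm_real, Real.norm_eq_abs, abs_of_nonneg (by positivity)]
    have hcB' : ‖(((cB * M ^ (-(1 / 2 : ℝ)) : ℝ)) : ℂ)‖ = cB * M ^ (-(1 / 2 : ℝ)) := by
      rw [Complex.norm_real, Real.norm_eq_abs, abs_of_nonneg (by positivity)]
    rw [hcA', hcB'] at h
    refine h.trans (le_of_eq ?_)
    push_cast
    ring
  -- positive shifts
  have hpos := hbox 1 (Or.inl rfl) (fun k m r => k * m + r) (fun k hk m hm r _ _ =>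
    ⟨by nlinarith [(Finset.mem_Icc.mp hk).1, (Finset.mem_Icc.mp hm).1], by push_cast; ring⟩)
  -- negative shifts: on the support `r < km`
  have hlt : ∀ k ∈ Finset.Icc 1 ⌊2 * K⌋₊, ∀ m ∈ Finset.Icc 1 ⌊2 * M⌋₊, ∀ r ∈ Finset.Icc 1 ⌊2 * R⌋₊,
      bump ((k : ℝ) / K) ≠ 0 ∧ bump ((m : ℝ) / M) ≠ 0 ∧ bump ((r : ℝ) / R) ≠ 0 → r < k * m := by
    intro k hk m hm r hr hb
    obtain ⟨_, _, h3, h4, _⟩ := support_bounds hK0 hM0 hR0 hb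
    have hr' : (r : ℝ) < (k : ℝ) * m := by nlinarith [h3.2, h4.1, h2R]
    exact_mod_cast hr'
  have hneg := hbox (-1) (Or.inr rfl) (fun k m r => k * m - r) (fun k hk m hm r hr hb => by
    have h := hlt k hk m hm r hr hb
    refine ⟨by omega, ?_⟩
    rw [Nat.cast_sub h.le]; push_cast; ring)
  rw [odBoxNeg_eq_sum_of_lt c w B ρ χ K M R hlt]
  unfold odBoxPos
  linarith [hpos, hneg]


/-! ### I. All boxes at a fixed modulus ("summing the `≪ (log T)^{O(1)}` partitions", TeX l.838) -/

/-- The separated `r`-weight `γ_R(z)(x) = ω(x/R)² (x/R)^{−z}` lies in the corrected class with the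
family of `MellinSeparatedWeights` built on the bump² derivative family of
`BondarenkoHeap2026OffDiagPartition`. [cite: BondarenkoHeap2026, §6.2, TeX l.831] -/
theorem exists_family_gamma :
    ∃ A : ℕ → ℝ, ∀ (R : ℝ), 0 < R → ∀ (z : ℂ), 0 ≤ z.re →
      IsSmoothDyadicWeight' R A (1 + ‖z‖)
        (fun x : ℝ => ((bump (x / R) ^ 2 : ℝ) : ℂ) * (((x / R : ℝ)) : ℂ) ^ (-z)) := by
  obtain ⟨Bγ, hB0, _, hB⟩ := exists_family_iteratedDeriv_bump_sq_ofReal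
  have hW : ContDiff ℝ ∞ fun y : ℝ => ((bump y ^ 2 : ℝ) : ℂ) :=
    Complex.ofRealCLM.contDiff.comp bump_sq_contDiff
  have hsupp : ∀ y : ℝ, ((bump y ^ 2 : ℝ) : ℂ) ≠ 0 → 1 ≤ y ∧ y ≤ 2 := by
    intro y hy
    have h : bump y ≠ 0 := fun h0 => hy (by rw [h0]; simp)
    have := SmoothDyadicPartition.bump_ne_zero_imp h
    exact ⟨this.1.le, this.2.le⟩
  exact ⟨_, fun R hR z hz => MellinSeparated.isSmoothDyadicWeight'_separatedWeight hW hsupp hB hB0 hz hR⟩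

/-- `Σ_{k ≤ 2K} log k ≤ (2K)²` (`log k ≤ k ≤ 2K`, at most `2K` terms). [folklore] -/
private theorem sum_log_le_sq {K : ℝ} (hK : 0 < K) :
    ∑ k ∈ Finset.Icc 1 ⌊2 * K⌋₊, Real.log k ≤ (2 * K) ^ 2 := by
  have hcard : ((Finset.Icc 1 ⌊2 * K⌋₊).card : ℝ) ≤ 2 * K := by
    rw [Nat.card_Icc]; simp only [add_tsub_cancel_right]; exact Nat.floor_le (by positivity)
  have hterm : ∀ k ∈ Finset.Icc 1 ⌊2 * K⌋₊, Real.log k ≤ 2 * K := by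
    intro k hk
    have hk2 : (k : ℝ) ≤ 2 * K :=
      le_trans (by exact_mod_cast (Finset.mem_Icc.mp hk).2) (Nat.floor_le (by positivity))
    have hk0 : (0 : ℝ) < k := by exact_mod_cast (Finset.mem_Icc.mp hk).1
    exact ((Real.log_le_sub_one_of_pos hk0).trans (by linarith)).trans hk2
  calc ∑ k ∈ Finset.Icc 1 ⌊2 * K⌋₊, Real.log k ≤ ∑ k ∈ Finset.Icc 1 ⌊2 * K⌋₊, 2 * K :=
        Finset.sum_le_sum hterm
    _ = (Finset.Icc 1 ⌊2 * K⌋₊).card * (2 * K) := by rw [Finset.sum_const, nsmul_eq_mul]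
    _ ≤ 2 * K * (2 * K) := mul_le_mul_of_nonneg_right hcard (by positivity)
    _ = (2 * K) ^ 2 := by ring


/-- `x^{-1/2}·y^{-1/2}·(xy/2)^{-1/2}·(xy) = √2` for `x, y > 0` (the normalisation of the main term:
`K^{-1/2} M^{-1/2} N₀^{-1/2} · KM` with `N₀ = KM/2`). [folklore] -/
private theorem norm_main_const {x y : ℝ} (hx : 0 < x) (hy : 0 < y) :
    x ^ (-(1 / 2 : ℝ)) * y ^ (-(1 / 2 : ℝ)) * (x * y / 2) ^ (-(1 / 2 : ℝ)) * (x * y) = Real.sqrt 2 := by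
  have hxy : 0 < x * y := mul_pos hx hy
  rw [← Real.mul_rpow hx.le hy.le, Real.div_rpow hxy.le (by norm_num),
    Real.rpow_neg (by norm_num : (0:ℝ) ≤ 2), ← Real.sqrt_eq_rpow 2, div_inv_eq_mul]
  have h1 : (x * y) ^ (-(1 / 2 : ℝ)) * (x * y) ^ (-(1 / 2 : ℝ)) = (x * y)⁻¹ := by
    rw [← Real.rpow_add hxy, show (-(1 / 2 : ℝ)) + -(1 / 2 : ℝ) = -1 by norm_num, Real.rpow_neg_one]
  calc (x * y) ^ (-(1 / 2 : ℝ)) * ((x * y) ^ (-(1 / 2 : ℝ)) * Real.sqrt 2) * (x * y)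
      = ((x * y) ^ (-(1 / 2 : ℝ)) * (x * y) ^ (-(1 / 2 : ℝ))) * (x * y) * Real.sqrt 2 := by ring
    _ = Real.sqrt 2 := by rw [h1, inv_mul_cancel₀ hxy.ne', one_mul]


/-- `(xy/2)^{-1/2} ≤ √2` for `xy ≥ 1`. [folklore] -/
private theorem N₀_rpow_le {x : ℝ} (hx : 1 ≤ x) : (x / 2) ^ (-(1 / 2 : ℝ)) ≤ Real.sqrt 2 := by
  have hx0 : 0 < x := by linarith
  rw [Real.div_rpow hx0.le (by norm_num), Real.rpow_neg (by norm_num : (0:ℝ) ≤ 2),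
    ← Real.sqrt_eq_rpow 2, div_inv_eq_mul]
  have h1 : x ^ (-(1 / 2 : ℝ)) ≤ 1 := Real.rpow_le_one_of_one_le_of_nonpos hx (by norm_num)
  have hs : 0 ≤ Real.sqrt 2 := Real.sqrt_nonneg 2
  nlinarith

set_option maxHeartbeats 800000 in
/-- **All boxes at a fixed modulus** ("after integrating, and then summing the
`≪ (log T)^{O(1)}` partitions", TeX l.838): with the box decomposition `offDiagOD_eq_sum_boxes` of
the sibling `BondarenkoHeap2026OffDiagPartition`, the admissibility of contributing boxes, and
`admissible_box_bound` fed by a power-saving bound for `E(K,M,R)` over the corrected weight class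
at loss `Q ≥ 3H` (the separated weights have loss `1 + ‖z‖ ≤ 3H`), `|𝒪𝒟|` is at most the number
of boxes times a uniform box bound: a main part `≍ T H² q^{−θ}` and a truncation part
`≍ L³ T H τ`. [cite: BondarenkoHeap2026, §6.2, TeX l.825–841] -/
theorem offDiagOD_abs_le_at (c : ℝ) (w : Bump) (B : ℕ) (ρ : Resonator) {q : ℕ} [NeZero q]
    {χ : DirichletCharacter ℂ q} (hχ : χ.IsQuadratic) (hq : 2 ≤ q) {C₀ : ℝ}
    (hC₀def : C₀ = max (32 * π * w.σ) 3) (hT8 : 8 * C₀ ≤ ρ.T q)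
    (hTσ : 4 * π * w.σ / Real.log 2 < ρ.T q) {J₁ J₂ J₃ : ℕ}
    (hJ₁ : (⌈lengthL q * Real.exp (4 * π * w.σ / ρ.T q)⌉₊ : ℝ) ≤ Real.sqrt 2 ^ J₁)
    (hJ₂ : (⌊lengthL q⌋₊ : ℝ) ≤ Real.sqrt 2 ^ J₂)
    (hJ₃ : 8 * π * w.σ * Real.sqrt 2 ^ J₁ * Real.sqrt 2 ^ J₂ / ρ.T q ≤ Real.sqrt 2 ^ J₃)
    {H : ℝ} (hH : 1 ≤ H) (hHT : H ≤ ρ.T q)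
    (V : ℝ → ℝ → ℂ) (W : ℝ → ℤ → ℝ → ℝ → ℂ)
    (hVid : ∀ (N : ℝ) (n : ℕ), 1 ≤ n → 0 < N →
      ((ρ.G q n / Real.sqrt n * bump ((n : ℝ) / N) ^ 2 : ℝ) : ℂ) =
        (((N ^ (-(1 / 2 : ℝ)) : ℝ)) : ℂ) * V N ((n : ℝ) / N))
    (hWid : ∀ (U : ℝ) (s : ℤ) (t u : ℝ), 0 < U → 0 < u → 0 < 1 + (s : ℝ) * u →
      ((weightHat w B (ρ.T q) (Real.log (1 + (s : ℝ) * u) / (2 * π)) * bump (u / U) ^ 2 : ℝ) : ℂ) *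
          (((1 + (s : ℝ) * u : ℝ)) : ℂ) ^ (-(t * I)) = (ρ.T q : ℂ) * W U s t (u / U))
    (hWc : ∀ (U : ℝ) (s : ℤ) (v : ℝ), 0 < U → U ≤ 1 / 4 → (s = 1 ∨ s = -1) →
      Continuous fun t => W U s t v)
    {DV DW τA τB : ℝ} (hDV : 0 ≤ DV) (hDW : 0 ≤ DW) (hτA : 0 ≤ τA) (hτB : 0 ≤ τB)
    (hVc : ∀ N : ℝ, 0 < N → Continuous (V N) ∧ ∀ y, V N y ≠ 0 → 1 ≤ y ∧ y ≤ 2)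
    (hVdec : ∀ N : ℝ, 2⁻¹ ≤ N → N ≤ 4 * C₀ * lengthL q →
      (∀ t : ℝ, ‖mellin (V N) (t * I)‖ ≤ DV) ∧
        ∀ y : ℝ, 0 < y → ‖V N y - (1 / (2 * π)) • ∫ t in -H..H,
          mellin (V N) (t * I) * ((y : ℝ) : ℂ) ^ (-(t * I))‖ ≤ τA)
    (hWdec : ∀ U : ℝ, 0 < U → U ≤ 1 / 4 → U * ρ.T q ≤ 2 * C₀ → ∀ s : ℤ, (s = 1 ∨ s = -1) →
      ∀ t : ℝ, U * |t| ≤ 2 * C₀ →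
        (∀ t' : ℝ, ‖mellin (W U s t) (t' * I)‖ ≤ DW) ∧
          ∀ v : ℝ, 0 < v → ‖W U s t v - (1 / (2 * π)) • ∫ t' in -H..H,
            mellin (W U s t) (t' * I) * ((v : ℝ) : ℂ) ^ (-(t' * I))‖ ≤ τB)
    (hWcont : ∀ (U : ℝ) (s : ℤ), 0 < U → U ≤ 1 / 4 → (s = 1 ∨ s = -1) →
      Continuous fun p : ℝ × ℝ => mellin (W U s p.1) (p.2 * I))
    (α β : ℝ → ℂ → ℝ → ℂ) {cA cB : ℝ} (hcA : 0 ≤ cA) (hcB : 0 ≤ cB)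
    (hαid : ∀ (K : ℝ) (z : ℂ) (k : ℕ), 1 ≤ k → 0 < K →
      ((gWeight (gapWidth c (ρ.T q)) k / Real.sqrt k * bump ((k : ℝ) / K) ^ 2 : ℝ) : ℂ) *
        ((((k : ℝ) / K : ℝ)) : ℂ) ^ (-z) = (((cA * K ^ (-(1 / 2 : ℝ)) : ℝ)) : ℂ) * α K z k)
    (hβid : ∀ (M : ℝ) (z : ℂ) (m : ℕ), 1 ≤ m → 0 < M →
      ((ρ.G q m / Real.sqrt m * bump ((m : ℝ) / M) ^ 2 : ℝ) : ℂ) * ((((m : ℝ) / M : ℝ)) : ℂ) ^ (-z) =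
        (((cB * M ^ (-(1 / 2 : ℝ)) : ℝ)) : ℂ) * β M z m)
    {A : ℕ → ℝ} {Q : ℝ} (hQ : 3 * H ≤ Q)
    (hαmem : ∀ K : ℝ, Real.sqrt 2 ≤ K → ∀ z : ℂ, 0 ≤ z.re → IsSmoothDyadicWeight' K A (1 + ‖z‖) (α K z))
    (hβmem : ∀ M : ℝ, 2⁻¹ ≤ M → ∀ z : ℂ, 0 ≤ z.re → IsSmoothDyadicWeight' M A (1 + ‖z‖) (β M z))
    (hγmem : ∀ R : ℝ, 0 < R → ∀ z : ℂ, 0 ≤ z.re → IsSmoothDyadicWeight' R A (1 + ‖z‖)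
      (fun x : ℝ => ((bump (x / R) ^ 2 : ℝ) : ℂ) * (((x / R : ℝ)) : ℂ) ^ (-z)))
    {C θ : ℝ} (hC : 0 ≤ C)
    (HB : ∀ (K M R : ℝ), IsAdmissibleScale' q ρ.δ C₀ K M R → ∀ s : ℤ, (s = 1 ∨ s = -1) →
      ∀ a b cf : ℝ → ℂ, IsSmoothDyadicWeight' K A Q a → IsSmoothDyadicWeight' M A Q b →
        IsSmoothDyadicWeight' R A Q cf → ‖corrSumE χ s K M R a b cf‖ ≤ C * (K * M) * (q : ℝ) ^ (-θ))
    {GB WB : ℝ} (hG : ∀ n : ℕ, |ρ.G q n| ≤ GB) (hWB : ∀ ξ : ℝ, |weightHat w B (ρ.T q) ξ| ≤ WB) :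
    |offDiagOD c w B ρ χ| ≤ (((J₁ + 1 : ℕ) : ℝ) * ((J₂ + 1 : ℕ) : ℝ) * ((J₃ + 1 : ℕ) : ℝ)) *
      (2 * ((7 : ℝ) * 7 *
        (cA * cB * (Real.sqrt 2 * ρ.T q * (1 / (2 * π)) ^ 2) * ((2 * H) ^ 2 * (DV * DW * (C * (q : ℝ) ^ (-θ)))) +
          16 * Real.sqrt 2 * C₀ ^ 4 * lengthL q ^ 3 *
            (2 * GB * Real.sqrt 2 * (τA * WB + 1 / (2 * π) * (2 * H) * DV * ρ.T q * τB))))) := by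
  have hq1 : 1 ≤ q := le_trans (by norm_num) hq
  have hs2 : (1 : ℝ) < Real.sqrt 2 := Real.one_lt_sqrt_two
  have hs0 : (0 : ℝ) < Real.sqrt 2 := by linarith
  have hC₀3 : 3 ≤ C₀ := by rw [hC₀def]; exact le_max_right _ _
  have hC₀1 : 1 ≤ C₀ := by linarith
  have hT0 : 0 < ρ.T q := by linarith
  have hT1 : 1 ≤ ρ.T q := by linarith
  have hL0 : 0 < lengthL q := by unfold lengthL; positivity
  have hGB0 : 0 ≤ GB := (abs_nonneg _).trans (hG 0)
  have hWB0 : 0 ≤ WB := (abs_nonneg _).trans (hWB 0)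
  have hH0 : 0 < H := by linarith
  have hqθ : 0 ≤ (q : ℝ) ^ (-θ) := Real.rpow_nonneg (Nat.cast_nonneg q) _
  -- the uniform box bound
  set BOX : ℝ := 2 * ((7 : ℝ) * 7 *
    (cA * cB * (Real.sqrt 2 * ρ.T q * (1 / (2 * π)) ^ 2) * ((2 * H) ^ 2 * (DV * DW * (C * (q : ℝ) ^ (-θ)))) +
      16 * Real.sqrt 2 * C₀ ^ 4 * lengthL q ^ 3 *
        (2 * GB * Real.sqrt 2 * (τA * WB + 1 / (2 * π) * (2 * H) * DV * ρ.T q * τB)))) with hBOX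
  have hBOX0 : 0 ≤ BOX := by simp only [hBOX]; positivity
  have hbox : ∀ i j l : ℕ,
      |odBoxPos c w B ρ χ (Real.sqrt 2 ^ ((i : ℤ) - 1)) (Real.sqrt 2 ^ ((j : ℤ) - 1))
          (Real.sqrt 2 ^ ((l : ℤ) - 1))| +
        |odBoxNeg c w B ρ χ (Real.sqrt 2 ^ ((i : ℤ) - 1)) (Real.sqrt 2 ^ ((j : ℤ) - 1))
          (Real.sqrt 2 ^ ((l : ℤ) - 1))| ≤ BOX := by
    intro i j l
    set K : ℝ := Real.sqrt 2 ^ ((i : ℤ) - 1) with hKdef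
    set M : ℝ := Real.sqrt 2 ^ ((j : ℤ) - 1) with hMdef
    set R : ℝ := Real.sqrt 2 ^ ((l : ℤ) - 1) with hRdef
    by_cases h0 : odBoxPos c w B ρ χ K M R = 0 ∧ odBoxNeg c w B ρ χ K M R = 0
    · rw [h0.1, h0.2, abs_zero, add_zero]; exact hBOX0
    have hne : odBoxPos c w B ρ χ K M R ≠ 0 ∨ odBoxNeg c w B ρ χ K M R ≠ 0 := by
      by_contra hcon; push Not at hcon; exact h0 hcon
    have hadm : IsAdmissibleScale' q ρ.δ C₀ K M R := by
      rw [hC₀def]; exact isAdmissibleScale'_of_odBox_ne_zero c w B ρ hq1 hTσ χ i j l hne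
    have hKge : Real.sqrt 2 ≤ K := sqrt_two_le_of_odBox_ne_zero c w B ρ χ i hne
    have hK0 : 0 < K := zpow_pos hs0 _
    have hM0 : 0 < M := zpow_pos hs0 _
    have hR0 : 0 < R := zpow_pos hs0 _
    have hMge : (Real.sqrt 2)⁻¹ ≤ M := by
      rw [hMdef, ← zpow_neg_one]
      exact zpow_le_zpow_right₀ hs2.le (by omega)
    have hKM1 : 1 ≤ K * M := by
      calc (1 : ℝ) = Real.sqrt 2 * (Real.sqrt 2)⁻¹ := by rw [mul_inv_cancel₀ hs0.ne']
        _ ≤ K * M := mul_le_mul hKge hMge (inv_nonneg.mpr hs0.le) hK0.le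
    have hKM0 : 0 < K * M := by positivity
    -- the power-saving bound on the truncated square, both signs
    have hE : ∀ s : ℤ, (s = 1 ∨ s = -1) → ∀ t ∈ Set.Icc (-H) H, ∀ t' ∈ Set.Icc (-H) H,
        ‖corrSumE χ s K M R (α K ((t - t') * I)) (β M ((t - t') * I))
          (fun x : ℝ => ((bump (x / R) ^ 2 : ℝ) : ℂ) * (((x / R : ℝ)) : ℂ) ^ (-(t' * I)))‖ ≤
          C * (K * M) * (q : ℝ) ^ (-θ) := by
      intro s hs t ht t' ht'
      have hz1 : (0 : ℝ) ≤ (((t : ℂ) - t') * I).re := by simp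
      have hz2 : (0 : ℝ) ≤ ((t' : ℂ) * I).re := by simp
      have hn1 : 1 + ‖((t : ℂ) - t') * I‖ ≤ Q := by
        have h1 : ‖((t : ℂ) - t') * I‖ = |t - t'| := by
          rw [norm_mul, Complex.norm_I, mul_one, ← Complex.ofReal_sub, Complex.norm_real,
            Real.norm_eq_abs]
        rw [h1]
        have : |t - t'| ≤ 2 * H := by
          rw [abs_le]; constructor <;> linarith [ht.1, ht.2, ht'.1, ht'.2]
        linarith
      have hn2 : 1 + ‖(t' : ℂ) * I‖ ≤ Q := by
        have h1 : ‖(t' : ℂ) * I‖ = |t'| := by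
          rw [norm_mul, Complex.norm_I, mul_one, Complex.norm_real, Real.norm_eq_abs]
        rw [h1]
        have : |t'| ≤ H := abs_le.mpr ⟨by linarith [ht'.1], ht'.2⟩
        linarith
      have hp1 : 0 < 1 + ‖((t : ℂ) - t') * I‖ := by positivity
      have hp2 : 0 < 1 + ‖(t' : ℂ) * I‖ := by positivity
      refine HB K M R hadm s hs _ _ _ ?_ ?_ ?_
      · exact (hαmem K hKge _ hz1).mono hK0 hp1 hn1
      · exact (hβmem M hadm.2.1 _ hz1).mono hM0 hp1 hn1
      · exact (hγmem R hR0 _ hz2).mono hR0 hp2 hn2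
    have hmain := admissible_box_bound hχ c w B ρ hC₀1 hT8 hKdef hMdef hRdef hKM1 hadm V W hVid
      hWid hWc hH hHT hDV hDW hτA hτB hVc hVdec hWdec hWcont (α K) (β M) hcA hcB
      (fun z k hk => hαid K z k hk hK0) (fun z m hm => hβid M z m hm hM0) hE hG hWB
    refine hmain.trans ?_
    simp only [hBOX]
    -- compare the two box constants
    have hmainc : (cA * K ^ (-(1 / 2 : ℝ))) * (cB * M ^ (-(1 / 2 : ℝ))) *
        ((K * M / 2) ^ (-(1 / 2 : ℝ)) * ρ.T q * (1 / (2 * π)) ^ 2) *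
        ((2 * H) ^ 2 * (DV * DW * (C * (K * M) * (q : ℝ) ^ (-θ)))) =
        cA * cB * (Real.sqrt 2 * ρ.T q * (1 / (2 * π)) ^ 2) *
          ((2 * H) ^ 2 * (DV * DW * (C * (q : ℝ) ^ (-θ)))) := by
      have h := norm_main_const hK0 hM0
      calc (cA * K ^ (-(1 / 2 : ℝ))) * (cB * M ^ (-(1 / 2 : ℝ))) *
            ((K * M / 2) ^ (-(1 / 2 : ℝ)) * ρ.T q * (1 / (2 * π)) ^ 2) *
            ((2 * H) ^ 2 * (DV * DW * (C * (K * M) * (q : ℝ) ^ (-θ))))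
          = cA * cB * ((K ^ (-(1 / 2 : ℝ)) * M ^ (-(1 / 2 : ℝ)) * (K * M / 2) ^ (-(1 / 2 : ℝ)) *
              (K * M)) * ρ.T q * (1 / (2 * π)) ^ 2) *
              ((2 * H) ^ 2 * (DV * DW * (C * (q : ℝ) ^ (-θ)))) := by ring
        _ = _ := by rw [h]
    rw [hmainc]
    -- the error constant: `(Σ log k) ⌊2M⌋ ⌊2R⌋ (KM/2)^{-1/2} ≤ 16 √2 C₀^4 L^3 · √2`
    have hlog : ∑ k ∈ Finset.Icc 1 ⌊2 * K⌋₊, Real.log k ≤ (2 * K) ^ 2 := sum_log_le_sq hK0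
    have hfl : ((⌊2 * M⌋₊ : ℝ) * (⌊2 * R⌋₊ : ℝ)) ≤ (2 * M) * (2 * R) :=
      mul_le_mul (Nat.floor_le (by positivity)) (Nat.floor_le (by positivity)) (Nat.cast_nonneg _)
        (by positivity)
    have hN₀ : (K * M / 2) ^ (-(1 / 2 : ℝ)) ≤ Real.sqrt 2 := N₀_rpow_le hKM1
    have hKle : K ≤ Real.sqrt 2 * C₀ * lengthL q := by
      have h1 : K ≤ Real.sqrt 2 * (K * M) := by
        calc K = K * M * M⁻¹ := by field_simp
          _ ≤ K * M * Real.sqrt 2 := by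
              refine mul_le_mul_of_nonneg_left ?_ hKM0.le
              calc M⁻¹ ≤ ((Real.sqrt 2)⁻¹)⁻¹ := inv_anti₀ (inv_pos.mpr hs0) hMge
                _ = Real.sqrt 2 := inv_inv _
          _ = Real.sqrt 2 * (K * M) := by ring
      have h2 : K * M ≤ C₀ * lengthL q := by have := hadm.2.2.2.2; simpa [lengthL] using this
      nlinarith
    have hRle : R ≤ C₀ ^ 2 * lengthL q := by
      have h1 : R ≤ C₀ * (K * M) / ρ.T q := by have := hadm.2.2.2.1; simpa [Resonator.T] using this
      have h2 : K * M ≤ C₀ * lengthL q := by have := hadm.2.2.2.2; simpa [lengthL] using this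
      calc R ≤ C₀ * (K * M) / ρ.T q := h1
        _ ≤ C₀ * (K * M) := div_le_self (by positivity) hT1
        _ ≤ C₀ * (C₀ * lengthL q) := mul_le_mul_of_nonneg_left h2 (by linarith)
        _ = C₀ ^ 2 * lengthL q := by ring
    have hKMle : K * M ≤ C₀ * lengthL q := by have := hadm.2.2.2.2; simpa [lengthL] using this
    have hprod : (2 * K) ^ 2 * ((2 * M) * (2 * R)) ≤ 16 * Real.sqrt 2 * C₀ ^ 4 * lengthL q ^ 3 := by
      have h1 : (2 * K) ^ 2 * ((2 * M) * (2 * R)) = 16 * (K * (K * M) * R) := by ring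
      rw [h1]
      have h2 : K * (K * M) * R ≤ (Real.sqrt 2 * C₀ * lengthL q) * (C₀ * lengthL q) * (C₀ ^ 2 * lengthL q) :=
        mul_le_mul (mul_le_mul hKle hKMle hKM0.le (by positivity)) hRle hR0.le (by positivity)
      nlinarith
    have herr : (∑ k ∈ Finset.Icc 1 ⌊2 * K⌋₊, Real.log k) * ((⌊2 * M⌋₊ : ℝ) * (⌊2 * R⌋₊ : ℝ)) *
        (2 * GB * (K * M / 2) ^ (-(1 / 2 : ℝ)) * (τA * WB + 1 / (2 * π) * (2 * H) * DV * ρ.T q * τB)) ≤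
        16 * Real.sqrt 2 * C₀ ^ 4 * lengthL q ^ 3 *
          (2 * GB * Real.sqrt 2 * (τA * WB + 1 / (2 * π) * (2 * H) * DV * ρ.T q * τB)) := by
      have hlog0 : 0 ≤ ∑ k ∈ Finset.Icc 1 ⌊2 * K⌋₊, Real.log k :=
        Finset.sum_nonneg fun k _ => Real.log_natCast_nonneg k
      have h1 : (∑ k ∈ Finset.Icc 1 ⌊2 * K⌋₊, Real.log k) * ((⌊2 * M⌋₊ : ℝ) * (⌊2 * R⌋₊ : ℝ)) ≤
          16 * Real.sqrt 2 * C₀ ^ 4 * lengthL q ^ 3 :=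
        (mul_le_mul hlog hfl (by positivity) (by positivity)).trans hprod
      have h2 : 2 * GB * (K * M / 2) ^ (-(1 / 2 : ℝ)) * (τA * WB + 1 / (2 * π) * (2 * H) * DV * ρ.T q * τB) ≤
          2 * GB * Real.sqrt 2 * (τA * WB + 1 / (2 * π) * (2 * H) * DV * ρ.T q * τB) := by
        gcongr
      exact mul_le_mul h1 h2 (by positivity) (by positivity)
    linarith [herr]
  -- sum over the boxes
  rw [offDiagOD_eq_sum_boxes c w B ρ hq1 hTσ χ hJ₁ hJ₂ hJ₃]
  calc |∑ i ∈ Finset.range (J₁ + 1), ∑ j ∈ Finset.range (J₂ + 1), ∑ l ∈ Finset.range (J₃ + 1),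
        (odBoxPos c w B ρ χ (Real.sqrt 2 ^ ((i : ℤ) - 1)) (Real.sqrt 2 ^ ((j : ℤ) - 1))
            (Real.sqrt 2 ^ ((l : ℤ) - 1)) +
          odBoxNeg c w B ρ χ (Real.sqrt 2 ^ ((i : ℤ) - 1)) (Real.sqrt 2 ^ ((j : ℤ) - 1))
            (Real.sqrt 2 ^ ((l : ℤ) - 1)))|
      ≤ ∑ i ∈ Finset.range (J₁ + 1), ∑ j ∈ Finset.range (J₂ + 1), ∑ l ∈ Finset.range (J₃ + 1), BOX := by
        refine (Finset.abs_sum_le_sum_abs _ _).trans (Finset.sum_le_sum fun i _ => ?_)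
        refine (Finset.abs_sum_le_sum_abs _ _).trans (Finset.sum_le_sum fun j _ => ?_)
        refine (Finset.abs_sum_le_sum_abs _ _).trans (Finset.sum_le_sum fun l _ => ?_)
        exact (abs_add_le _ _).trans (hbox i j l)
    _ = (((J₁ + 1 : ℕ) : ℝ) * ((J₂ + 1 : ℕ) : ℝ) * ((J₃ + 1 : ℕ) : ℝ)) * BOX := by
        simp only [Finset.sum_const, Finset.card_range, nsmul_eq_mul]; push_cast; ring

/-! ## J. Counting the boxes and the asymptotic assembly

TeX l.838: "after integrating, and then summing the `≪ (\log T)^{O(1)}` partitions". The number of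
`√2`-adic boxes `(J₁+1)(J₂+1)(J₃+1)` of `offDiagOD_eq_sum_boxes` is `≪_{σ} (log q)³ ≪_{σ,η} q^η`
(our explicit count; the paper only records `(log T)^{O(1)}`). -/

/-- `√2^J ≤ √2 · Y` when `J ≤ 2 log Y / log 2 + 1` and `Y ≥ 1`. [folklore] -/
private theorem sqrt_two_pow_le_of_le_log {J : ℕ} {Y : ℝ} (hY : 1 ≤ Y)
    (hJ : (J : ℝ) ≤ 2 * Real.log Y / Real.log 2 + 1) :
    Real.sqrt 2 ^ J ≤ Real.sqrt 2 * Y := by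
  have hl2 : 0 < Real.log 2 := Real.log_pos one_lt_two
  have hs0 : 0 < Real.sqrt 2 := Real.sqrt_pos.mpr two_pos
  have hY0 : 0 < Y := by linarith
  have hlogs : Real.log (Real.sqrt 2) = Real.log 2 / 2 := by
    rw [Real.sqrt_eq_rpow, Real.log_rpow two_pos]; ring
  rw [← Real.log_le_log_iff (pow_pos hs0 _) (mul_pos hs0 hY0), Real.log_pow,
    Real.log_mul hs0.ne' hY0.ne', hlogs]
  have h := mul_le_mul_of_nonneg_right hJ (div_pos hl2 two_pos).le
  calc (J : ℝ) * (Real.log 2 / 2) ≤ (2 * Real.log Y / Real.log 2 + 1) * (Real.log 2 / 2) := h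
    _ = Real.log 2 / 2 + Real.log Y := by field_simp; ring

set_option maxHeartbeats 400000 in
/-- **The number of boxes is `≪_{σ,η} q^η`** (TeX l.838 "summing the `≪ (\log T)^{O(1)}`
partitions"; our explicit form: with the index bounds of `exists_box_indices`,
`(J₁+1)(J₂+1)(J₃+1) ≤ C_{σ,η} q^η` for every `η > 0`, `q ≥ 2`, `4πσ/log 2 < T`, `T ≥ 1`).
[cite: BondarenkoHeap2026, §6.2, TeX l.838] -/
theorem box_count_le (w : Bump) (ρ : Resonator) {η : ℝ} (hη : 0 < η) :
    ∃ Cn : ℝ, 0 < Cn ∧ ∀ (q : ℕ), 2 ≤ q → 4 * π * w.σ / Real.log 2 < ρ.T q → 1 ≤ ρ.T q →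
      ∀ (J₁ J₂ J₃ : ℕ),
        (J₁ : ℝ) ≤ 2 * Real.log (⌈lengthL q * Real.exp (4 * π * w.σ / ρ.T q)⌉₊ : ℕ) /
            Real.log 2 + 1 →
        (J₂ : ℝ) ≤ 2 * Real.log (max 1 (⌊lengthL q⌋₊ : ℝ)) / Real.log 2 + 1 →
        (J₃ : ℝ) ≤ 2 * Real.log (max 1 (8 * π * w.σ * Real.sqrt 2 ^ J₁ * Real.sqrt 2 ^ J₂ / ρ.T q)) /
            Real.log 2 + 1 →
        ((J₁ + 1 : ℕ) : ℝ) * ((J₂ + 1 : ℕ) : ℝ) * ((J₃ + 1 : ℕ) : ℝ) ≤ Cn * (q : ℝ) ^ η := by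
  set cσ : ℝ := Real.log (max 1 (48 * π * w.σ)) with hcσ
  have hcσ0 : 0 ≤ cσ := Real.log_nonneg (le_max_left _ _)
  set b : ℝ := max 10 (4 * cσ + 2) with hb
  have hb10 : 10 ≤ b := le_max_left _ _
  have hb' : 4 * cσ + 2 ≤ b := le_max_right _ _
  have hb0 : 0 ≤ b := le_trans (by norm_num) hb10
  refine ⟨(b + 72 / η) ^ 3, by positivity, ?_⟩
  intro q hq hTσ hT1 J₁ J₂ J₃ hJ₁ hJ₂ hJ₃
  have hσ := w.σ_pos
  have hl2 : (1 : ℝ) / 2 < Real.log 2 := by have := Real.log_two_gt_d9; linarith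
  have hl2' : 0 < Real.log 2 := by linarith
  have hq1 : (1 : ℝ) ≤ q := by exact_mod_cast (le_trans one_le_two hq)
  have hq0 : (0 : ℝ) < q := by linarith
  have hlq : 0 ≤ Real.log q := Real.log_nonneg hq1
  have hL1 : 1 ≤ lengthL q := Real.one_le_rpow hq1 (by norm_num)
  have hL0 : 0 < lengthL q := by linarith
  have hlogL : Real.log (lengthL q) = 17 / 6 * Real.log q := by
    unfold lengthL; rw [Real.log_rpow hq0]
  have hT0 : 0 < ρ.T q := by linarith
  have hs0 : 0 < Real.sqrt 2 := Real.sqrt_pos.mpr two_pos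
  have hs22 : Real.sqrt 2 * Real.sqrt 2 = 2 := Real.mul_self_sqrt zero_le_two
  -- the first index
  set Y₁ : ℕ := ⌈lengthL q * Real.exp (4 * π * w.σ / ρ.T q)⌉₊ with hY₁
  have hexp : Real.exp (4 * π * w.σ / ρ.T q) ≤ 2 := by
    have h1 : 4 * π * w.σ / ρ.T q < Real.log 2 := by
      rw [div_lt_iff₀ hT0]; rw [div_lt_iff₀ hl2'] at hTσ; linarith
    have := Real.exp_le_exp.mpr h1.le
    rwa [Real.exp_log two_pos] at this
  have hY₁le : (Y₁ : ℝ) ≤ 3 * lengthL q := by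
    have h1 : (Y₁ : ℝ) < lengthL q * Real.exp (4 * π * w.σ / ρ.T q) + 1 :=
      Nat.ceil_lt_add_one (by positivity)
    have h2 : lengthL q * Real.exp (4 * π * w.σ / ρ.T q) ≤ lengthL q * 2 :=
      mul_le_mul_of_nonneg_left hexp hL0.le
    linarith
  have hY₁ge : (1 : ℝ) ≤ (Y₁ : ℝ) := by
    have : 1 ≤ Y₁ := Nat.one_le_iff_ne_zero.mpr (Nat.ceil_pos.mpr (by positivity)).ne'
    exact_mod_cast this
  have hlog3 : Real.log 3 ≤ 2 := by
    have := Real.log_le_sub_one_of_pos (by norm_num : (0 : ℝ) < 3); linarith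
  have hlogY₁ : Real.log (Y₁ : ℝ) ≤ 2 + 3 * Real.log q := by
    calc Real.log (Y₁ : ℝ) ≤ Real.log (3 * lengthL q) := Real.log_le_log (by linarith) hY₁le
      _ = Real.log 3 + 17 / 6 * Real.log q := by rw [Real.log_mul (by norm_num) hL0.ne', hlogL]
      _ ≤ 2 + 3 * Real.log q := by linarith
  have hF₁ : ((J₁ + 1 : ℕ) : ℝ) ≤ b + 24 * Real.log q := by
    push_cast
    have hx : 0 ≤ (2 + 3 * Real.log (q : ℝ)) * (Real.log 2 - 1 / 2) :=
      mul_nonneg (by linarith) (by linarith)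
    have : 2 * Real.log (Y₁ : ℝ) / Real.log 2 ≤ 2 * (2 + 3 * Real.log q) * 2 := by
      rw [div_le_iff₀ hl2']; linarith [hlogY₁, hx]
    linarith
  -- the second index
  have hY₂le : max 1 (⌊lengthL q⌋₊ : ℝ) ≤ lengthL q := max_le hL1 (Nat.floor_le hL0.le)
  have hY₂ge : (1 : ℝ) ≤ max 1 (⌊lengthL q⌋₊ : ℝ) := le_max_left _ _
  have hlogY₂ : Real.log (max 1 (⌊lengthL q⌋₊ : ℝ)) ≤ 3 * Real.log q := by
    calc Real.log (max 1 (⌊lengthL q⌋₊ : ℝ)) ≤ Real.log (lengthL q) :=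
          Real.log_le_log (by linarith) hY₂le
      _ = 17 / 6 * Real.log q := hlogL
      _ ≤ 3 * Real.log q := by linarith
  have hF₂ : ((J₂ + 1 : ℕ) : ℝ) ≤ b + 24 * Real.log q := by
    push_cast
    have hx : 0 ≤ (3 * Real.log (q : ℝ)) * (Real.log 2 - 1 / 2) :=
      mul_nonneg (by linarith) (by linarith)
    have : 2 * Real.log (max 1 (⌊lengthL q⌋₊ : ℝ)) / Real.log 2 ≤ 2 * (3 * Real.log q) * 2 := by
      rw [div_le_iff₀ hl2']; linarith [hlogY₂, hx]
    linarith
  -- the third index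
  have hp₁ : Real.sqrt 2 ^ J₁ ≤ Real.sqrt 2 * Y₁ := sqrt_two_pow_le_of_le_log hY₁ge hJ₁
  have hp₂ : Real.sqrt 2 ^ J₂ ≤ Real.sqrt 2 * max 1 (⌊lengthL q⌋₊ : ℝ) :=
    sqrt_two_pow_le_of_le_log hY₂ge hJ₂
  set Z : ℝ := 8 * π * w.σ * Real.sqrt 2 ^ J₁ * Real.sqrt 2 ^ J₂ / ρ.T q with hZ
  have hZle : Z ≤ 48 * π * w.σ * lengthL q ^ 2 := by
    have h12 : Real.sqrt 2 ^ J₁ * Real.sqrt 2 ^ J₂ ≤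
        (Real.sqrt 2 * (3 * lengthL q)) * (Real.sqrt 2 * lengthL q) :=
      mul_le_mul (hp₁.trans (mul_le_mul_of_nonneg_left hY₁le hs0.le))
        (hp₂.trans (mul_le_mul_of_nonneg_left hY₂le hs0.le)) (by positivity) (by positivity)
    have hnum : 8 * π * w.σ * Real.sqrt 2 ^ J₁ * Real.sqrt 2 ^ J₂ ≤
        48 * π * w.σ * lengthL q ^ 2 := by
      calc 8 * π * w.σ * Real.sqrt 2 ^ J₁ * Real.sqrt 2 ^ J₂
          = 8 * π * w.σ * (Real.sqrt 2 ^ J₁ * Real.sqrt 2 ^ J₂) := by ring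
        _ ≤ 8 * π * w.σ * ((Real.sqrt 2 * (3 * lengthL q)) * (Real.sqrt 2 * lengthL q)) :=
          mul_le_mul_of_nonneg_left h12 (by positivity)
        _ = 24 * π * w.σ * lengthL q ^ 2 * (Real.sqrt 2 * Real.sqrt 2) := by ring
        _ = 48 * π * w.σ * lengthL q ^ 2 := by rw [hs22]; ring
    rw [hZ, div_le_iff₀ hT0]
    exact hnum.trans (le_mul_of_one_le_right (by positivity) hT1)
  have hY₃le : max 1 Z ≤ max 1 (48 * π * w.σ) * lengthL q ^ 2 := by
    have hL2 : (1 : ℝ) ≤ lengthL q ^ 2 := one_le_pow₀ hL1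
    refine max_le ?_ (hZle.trans (mul_le_mul_of_nonneg_right (le_max_right _ _) (by positivity)))
    calc (1 : ℝ) = 1 * 1 := by ring
      _ ≤ max 1 (48 * π * w.σ) * lengthL q ^ 2 :=
        mul_le_mul (le_max_left _ _) hL2 zero_le_one (le_trans zero_le_one (le_max_left _ _))
  have hY₃ge : (1 : ℝ) ≤ max 1 Z := le_max_left _ _
  have hlogY₃ : Real.log (max 1 Z) ≤ cσ + 6 * Real.log q := by
    calc Real.log (max 1 Z) ≤ Real.log (max 1 (48 * π * w.σ) * lengthL q ^ 2) :=
          Real.log_le_log (by linarith) hY₃le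
      _ = cσ + 2 * (17 / 6 * Real.log q) := by
          rw [Real.log_mul (by positivity) (by positivity), Real.log_pow, hlogL]; push_cast; ring
      _ ≤ cσ + 6 * Real.log q := by linarith
  have hF₃ : ((J₃ + 1 : ℕ) : ℝ) ≤ b + 24 * Real.log q := by
    push_cast
    have hx : 0 ≤ (cσ + 6 * Real.log (q : ℝ)) * (Real.log 2 - 1 / 2) :=
      mul_nonneg (by linarith) (by linarith)
    have : 2 * Real.log (max 1 Z) / Real.log 2 ≤ 2 * (cσ + 6 * Real.log q) * 2 := by
      rw [div_le_iff₀ hl2']; linarith [hlogY₃, hx]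
    linarith
  -- absorb the logarithm into `q^{η/3}`
  have hlq' : Real.log q ≤ (q : ℝ) ^ (η / 3) / (η / 3) := Real.log_le_rpow_div hq0.le (by positivity)
  have hqη : 1 ≤ (q : ℝ) ^ (η / 3) := Real.one_le_rpow hq1 (by positivity)
  have hfac : b + 24 * Real.log q ≤ (b + 72 / η) * (q : ℝ) ^ (η / 3) := by
    have h1 : 24 * Real.log q ≤ 72 / η * (q : ℝ) ^ (η / 3) := by
      calc 24 * Real.log q ≤ 24 * ((q : ℝ) ^ (η / 3) / (η / 3)) := by linarith
        _ = 72 / η * (q : ℝ) ^ (η / 3) := by field_simp; ring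
    have h2 : b ≤ b * (q : ℝ) ^ (η / 3) := le_mul_of_one_le_right hb0 hqη
    calc b + 24 * Real.log q ≤ b * (q : ℝ) ^ (η / 3) + 72 / η * (q : ℝ) ^ (η / 3) := add_le_add h2 h1
      _ = (b + 72 / η) * (q : ℝ) ^ (η / 3) := by ring
  set y : ℝ := (b + 72 / η) * (q : ℝ) ^ (η / 3) with hy
  have hy3 : y * y * y = (b + 72 / η) ^ 3 * (q : ℝ) ^ η := by
    have : (q : ℝ) ^ η = ((q : ℝ) ^ (η / 3)) ^ (3 : ℕ) := by
      rw [← Real.rpow_natCast, ← Real.rpow_mul hq0.le]; congr 1; push_cast; ring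
    rw [this, hy]; ring
  have h₁ := hF₁.trans hfac
  have h₂ := hF₂.trans hfac
  have h₃ := hF₃.trans hfac
  have hy0 : 0 ≤ y := le_trans (Nat.cast_nonneg _) h₁
  calc ((J₁ + 1 : ℕ) : ℝ) * ((J₂ + 1 : ℕ) : ℝ) * ((J₃ + 1 : ℕ) : ℝ) ≤ y * y * y :=
        mul_le_mul (mul_le_mul h₁ h₂ (Nat.cast_nonneg _) hy0) h₃ (Nat.cast_nonneg _)
          (mul_nonneg hy0 hy0)
    _ = (b + 72 / η) ^ 3 * (q : ℝ) ^ η := hy3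

end OffDiagAssembly

open OffDiagAssembly in
set_option maxHeartbeats 800000 in
/-- **The reduction of `𝒪𝒟` to the correlation sums `E(K,M,R)` — corrected form
`offDiag_reduction'`, PROVED.** TeX l.838–841: "after integrating, and then summing the
`≪ (\log T)^{O(1)}` partitions, that" `𝒪𝒟` is bounded by `q^ε T` times the maximum of
`E(K,M,R)/(KM)` over the admissible scales; as typed (`offDiag_reduction'`): a power saving
`q^{−θ}` for `E(K,M,R)/(KM)` on all primed-admissible scales and all weights of the class
`IsSmoothDyadicWeight'` (`CorrSumPowerSaving' δ θ`) gives, for every `ε > 0`,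
`|𝒪𝒟| ≤ C q^ε T q^{−θ}` for `q ≥ q₀`. Assembly (ours — nested one-variable truncated Mellin
inversions, see the module docstring): `OffDiagAssembly.offDiagOD_abs_le_at` at the kernels
`odV`, `odW`, `odAlpha`, `odBeta` of `BondarenkoHeap2026OffDiagKernels`, with `H = q^{ε₂}`,
`ε₂ = min(ε₁, ε, 1)/8`, `Q = q^{ε₁} ≥ 3H`, Mellin decay order `j = ⌈(11+θ)/ε₂⌉ + 2`,
`q₀ = max(2, ⌈8C₀ + 4πσ/log 2 + 2⌉, ⌈3^{1/ε₂}⌉)`, and the box count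
`OffDiagAssembly.box_count_le`. [cite: BondarenkoHeap2026, §6.2, TeX l.742–853 (l.838–841)] -/
theorem offDiag_reduction'_holds : offDiag_reduction' := by
  intro c hc w B ρ θ hθ hPS ε hε
  -- constants independent of `q`
  set C₀ : ℝ := max (32 * π * w.σ) 3 with hC₀def
  have hC₀3 : 3 ≤ C₀ := le_max_right _ _
  have hC₀pos : 0 < C₀ := by linarith
  have hσ := w.σ_pos
  obtain ⟨Aα, hAα⟩ := exists_family_odAlpha hc
  obtain ⟨Aβ, hAβ⟩ := exists_family_odBeta ρ
  obtain ⟨Aγ, hAγ⟩ := exists_family_gamma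
  set A : ℕ → ℝ := fun n => max (Aα n) (max (Aβ n) (Aγ n)) with hAdef
  have hA1 : ∀ n, Aα n ≤ A n := fun n => le_max_left _ _
  have hA2 : ∀ n, Aβ n ≤ A n := fun n => (le_max_left _ _).trans (le_max_right _ _)
  have hA3 : ∀ n, Aγ n ≤ A n := fun n => (le_max_right _ _).trans (le_max_right _ _)
  obtain ⟨ε₁, hε₁, C, hC, HB⟩ := hPS C₀ hC₀pos A
  set ε₂ : ℝ := min (min ε₁ ε) 1 / 8 with hε₂def
  have hm₁ : min (min ε₁ ε) 1 ≤ ε₁ := (min_le_left _ _).trans (min_le_left _ _)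
  have hm₂ : min (min ε₁ ε) 1 ≤ ε := (min_le_left _ _).trans (min_le_right _ _)
  have hm₃ : min (min ε₁ ε) 1 ≤ 1 := min_le_right _ _
  have hm0 : 0 < min (min ε₁ ε) 1 := lt_min (lt_min hε₁ hε) one_pos
  have hε₂pos : 0 < ε₂ := by rw [hε₂def]; positivity
  have hε₂ε₁ : 8 * ε₂ ≤ ε₁ := by rw [hε₂def]; linarith
  have hε₂ε : 8 * ε₂ ≤ ε := by rw [hε₂def]; linarith
  have hε₂1 : 8 * ε₂ ≤ 1 := by rw [hε₂def]; linarith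
  set j : ℕ := ⌈(11 + θ) / ε₂⌉₊ + 2 with hjdef
  have hj2 : 2 ≤ j := by rw [hjdef]; exact Nat.le_add_left _ _
  have hjε : 11 + θ ≤ ε₂ * (((j - 2 : ℕ) : ℝ)) := by
    have h1 : (11 + θ) / ε₂ ≤ (⌈(11 + θ) / ε₂⌉₊ : ℝ) := Nat.le_ceil _
    have h2 : ((j - 2 : ℕ) : ℝ) = (⌈(11 + θ) / ε₂⌉₊ : ℝ) := by rw [hjdef]; simp
    rw [h2]; rw [div_le_iff₀ hε₂pos] at h1; linarith
  obtain ⟨DV, hDV0, hDV⟩ := odV_mellin_decay ρ (4 * C₀) (by positivity) j hj2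
  obtain ⟨DV', hDV'0, hDV'⟩ := odV_truncated ρ (4 * C₀) (by positivity) j hj2
  obtain ⟨DW, hDW0, hDW⟩ := odW_mellin_decay w B (2 * C₀) (by positivity) j hj2
  obtain ⟨DW', hDW'0, hDW'⟩ := odW_truncated w B (2 * C₀) (by positivity) j hj2
  obtain ⟨GB, hGB0, hGB⟩ := exists_G_bound ρ
  obtain ⟨KW, hKW0, hKW⟩ := exists_weightHat_bounds w B
  obtain ⟨Cn, hCn0, hCn⟩ := box_count_le w ρ (η := ε / 2) (by positivity)
  have hnA : 0 ≤ nA c := le_trans zero_le_one (one_le_nA c)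
  have hnB : 0 ≤ nB ρ := le_trans zero_le_one (one_le_nB ρ)
  have hs0 : 0 < Real.sqrt 2 := Real.sqrt_pos.mpr two_pos
  -- the constants of the main and of the error term
  set cM : ℝ := 98 * (nA c * nB ρ * (Real.sqrt 2 * (1 / (2 * π)) ^ 2) *
    (2 ^ 2 * (DV * DW * C))) with hcM
  set cE : ℝ := 98 * (16 * Real.sqrt 2 * C₀ ^ 4 *
    (2 * GB * Real.sqrt 2 * (DV' * KW + 1 / (2 * π) * 2 * DV * DW'))) with hcE
  have hcM0 : 0 ≤ cM := by rw [hcM]; positivity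
  have hcE0 : 0 ≤ cE := by rw [hcE]; positivity
  -- the threshold
  set T₀ : ℝ := 8 * C₀ + 4 * π * w.σ / Real.log 2 + 2 with hT₀
  set q₀ : ℕ := max 2 (max ⌈T₀⌉₊ ⌈(3 : ℝ) ^ (1 / ε₂)⌉₊) with hq₀
  refine ⟨Cn * (cM + cE) + 1, by positivity, q₀, ?_⟩
  intro q _ χ hq hprim hquad
  -- facts about `q`
  have hq2 : 2 ≤ q := le_trans (le_max_left _ _) hq
  have hq1 : 1 ≤ q := le_trans one_le_two hq2
  have hq1r : (1 : ℝ) ≤ q := by exact_mod_cast hq1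
  have hq0 : (0 : ℝ) < q := by linarith
  have hqT₀ : T₀ ≤ q := by
    have h1 : ⌈T₀⌉₊ ≤ q := le_trans (le_max_left _ _) (le_trans (le_max_right _ _) hq)
    exact (Nat.le_ceil T₀).trans (by exact_mod_cast h1)
  have hq3 : (3 : ℝ) ^ (1 / ε₂) ≤ q := by
    have h1 : ⌈(3 : ℝ) ^ (1 / ε₂)⌉₊ ≤ q :=
      le_trans (le_max_right _ _) (le_trans (le_max_right _ _) hq)
    exact (Nat.le_ceil _).trans (by exact_mod_cast h1)
  have hl2 : 0 < Real.log 2 := Real.log_pos one_lt_two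
  have hσl : 0 ≤ 4 * π * w.σ / Real.log 2 := by positivity
  have hL0 : 0 < lengthL q := by unfold lengthL; positivity
  -- facts about `T = q^{7/3+δ}`
  have hTq : (q : ℝ) ≤ ρ.T q := by
    unfold Resonator.T
    calc (q : ℝ) = (q : ℝ) ^ (1 : ℝ) := (Real.rpow_one _).symm
      _ ≤ (q : ℝ) ^ (7 / 3 + ρ.δ) :=
        Real.rpow_le_rpow_of_exponent_le hq1r (by linarith [ρ.δ_pos])
  have hT8 : 8 * C₀ ≤ ρ.T q := by linarith
  have hTσ : 4 * π * w.σ / Real.log 2 < ρ.T q := by linarith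
  have hT2 : 2 ≤ ρ.T q := by linarith
  have hT1 : 1 ≤ ρ.T q := by linarith
  have hT0 : 0 < ρ.T q := by linarith
  -- `H = q^{ε₂}` and `Q = q^{ε₁} ≥ 3H`
  set H : ℝ := (q : ℝ) ^ ε₂ with hHdef
  have hH1 : 1 ≤ H := Real.one_le_rpow hq1r hε₂pos.le
  have hH0 : 0 < H := by linarith
  have hHT : H ≤ ρ.T q := by
    rw [hHdef]; unfold Resonator.T
    exact Real.rpow_le_rpow_of_exponent_le hq1r (by linarith [ρ.δ_pos])
  have hH3 : 3 ≤ H := by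
    have h3 : (3 : ℝ) = ((3 : ℝ) ^ (1 / ε₂)) ^ ε₂ := by
      rw [← Real.rpow_mul (by norm_num : (0 : ℝ) ≤ 3), one_div, inv_mul_cancel₀ hε₂pos.ne',
        Real.rpow_one]
    rw [h3, hHdef]; exact Real.rpow_le_rpow (by positivity) hq3 hε₂pos.le
  have hQ : 3 * H ≤ (q : ℝ) ^ ε₁ := by
    calc 3 * H ≤ H * H := mul_le_mul_of_nonneg_right hH3 hH0.le
      _ = (q : ℝ) ^ (ε₂ + ε₂) := by rw [hHdef, Real.rpow_add hq0]
      _ ≤ (q : ℝ) ^ ε₁ := Real.rpow_le_rpow_of_exponent_le hq1r (by linarith)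
  -- the boxes of `offDiagOD_eq_sum_boxes` and their number
  obtain ⟨J₁, J₂, J₃, hJ₁, hJ₂, hJ₃, hJ₁le, hJ₂le, hJ₃le⟩ := exists_box_indices w ρ hq1
  have hNB := hCn q hq2 hTσ hT1 J₁ J₂ J₃ hJ₁le hJ₂le hJ₃le
  -- `D (1+|t|)^{-j} ≤ D`
  have hdec : ∀ (D t : ℝ), 0 ≤ D → D * (1 + |t|) ^ (-(j : ℝ)) ≤ D := fun D t hD =>
    mul_le_of_le_one_right hD (Real.rpow_le_one_of_one_le_of_nonpos
      (by linarith [abs_nonneg t]) (by simp))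
  -- the fixed-`q` bound at the kernels of `BondarenkoHeap2026OffDiagKernels`
  have hmain := offDiagOD_abs_le_at c w B ρ hquad hq2 hC₀def hT8 hTσ hJ₁ hJ₂ hJ₃ hH1 hHT
    (odV ρ q) (odW w B (ρ.T q))
    (fun N n hn hN => odV_id ρ q hn hN)
    (fun U s t u hU _ _ => odW_id w B hT0 hU s t u)
    (fun U s v hU hU4 hs => continuous_odW_left w B (ρ.T q) hU hU4 hs v)
    (DV := DV) (DW := DW) (τA := DV' / H ^ (j - 1)) (τB := DW' / H ^ (j - 1))
    hDV0 hDW0 (by positivity) (by positivity)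
    (fun N hN => ⟨(contDiff_odV ρ q hN).continuous, fun y hy => odV_ne_zero_imp ρ q N hy⟩)
    (fun N hN hNL => ⟨fun t => (hDV q hq2 N hN hNL t).trans (hdec DV t hDV0),
      fun y hy => hDV' q hq2 N hN hNL H hH1 y hy⟩)
    (fun U hU hU4 hUT s hs t ht => ⟨fun t' => (hDW _ hT1 U hU hU4 hUT s hs t ht t').trans
        (hdec DW t' hDW0), fun v hv => hDW' _ hT1 U hU hU4 hUT s hs t ht H hH1 v hv⟩)
    (fun U s hU hU4 hs => continuous_mellin_odW w B hT1 hU hU4 hs)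
    (odAlpha c (ρ.T q)) (odBeta ρ q) (cA := nA c) (cB := nB ρ) hnA hnB
    (fun K z k hk hK => odAlpha_id c (ρ.T q) hk hK z)
    (fun M z m hm hM => odBeta_id ρ q hm hM z)
    (A := A) (Q := (q : ℝ) ^ ε₁) hQ
    (fun K hK z hz => isSmoothDyadicWeight'_mono_family (hAα _ hT2 K hK z hz)
      (lt_of_lt_of_le hs0 hK) (by positivity) hA1)
    (fun M hM z hz => isSmoothDyadicWeight'_mono_family (hAβ q hq2 M hM z hz)
      (lt_of_lt_of_le (by norm_num) hM) (by positivity) hA2)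
    (fun R hR z hz => isSmoothDyadicWeight'_mono_family (hAγ R hR z hz) hR (by positivity) hA3)
    (C := C) (θ := θ) hC.le
    (fun K M R hadm s hs a b cf ha hb hcf =>
      HB q χ hprim hquad K M R hadm trivial s hs a b cf ha hb hcf)
    (GB := GB) (WB := KW * ρ.T q) (fun n => hGB q n hq1) (hKW _ hT1).1
  -- absorption of the powers of `q`
  have hqθ : 0 ≤ (q : ℝ) ^ (-θ) := Real.rpow_nonneg hq0.le _
  have hqε4 : 1 ≤ (q : ℝ) ^ (ε / 4) := Real.one_le_rpow hq1r (by positivity)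
  -- (a) `H² ≤ q^{ε/4}`
  have hH2 : H ^ 2 ≤ (q : ℝ) ^ (ε / 4) := by
    have : H ^ 2 = (q : ℝ) ^ (ε₂ * 2) := by
      rw [hHdef, ← Real.rpow_natCast, ← Real.rpow_mul hq0.le]; norm_num
    rw [this]; exact Real.rpow_le_rpow_of_exponent_le hq1r (by linarith)
  -- (b) `L³ / H^{j−2} ≤ q^{−θ}` (`L³ = q^{17/2}`, `H^{j−2} ≥ q^{11+θ}`)
  have hL3 : lengthL q ^ 3 * (1 / H ^ (j - 2)) ≤ (q : ℝ) ^ (-θ) := by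
    have hL : lengthL q ^ 3 = (q : ℝ) ^ ((17 / 2 : ℝ)) := by
      unfold lengthL; rw [← Real.rpow_natCast, ← Real.rpow_mul hq0.le]; norm_num
    have hHj : (q : ℝ) ^ (11 + θ) ≤ H ^ (j - 2) := by
      rw [hHdef, ← Real.rpow_natCast, ← Real.rpow_mul hq0.le]
      exact Real.rpow_le_rpow_of_exponent_le hq1r hjε
    have h1 : 1 / H ^ (j - 2) ≤ (q : ℝ) ^ (-(11 + θ)) := by
      rw [Real.rpow_neg hq0.le, ← one_div]
      exact one_div_le_one_div_of_le (by positivity) hHj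
    calc lengthL q ^ 3 * (1 / H ^ (j - 2))
        ≤ (q : ℝ) ^ ((17 / 2 : ℝ)) * (q : ℝ) ^ (-(11 + θ)) := by
          rw [hL]; exact mul_le_mul_of_nonneg_left h1 (by positivity)
      _ = (q : ℝ) ^ ((17 / 2 : ℝ) + -(11 + θ)) := by rw [← Real.rpow_add hq0]
      _ ≤ (q : ℝ) ^ (-θ) := Real.rpow_le_rpow_of_exponent_le hq1r (by linarith)
  -- (c) `q^{ε/2} q^{ε/4} ≤ q^ε`
  have hqε : (q : ℝ) ^ (ε / 2) * (q : ℝ) ^ (ε / 4) ≤ (q : ℝ) ^ ε := by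
    rw [← Real.rpow_add hq0]; exact Real.rpow_le_rpow_of_exponent_le hq1r (by linarith)
  -- the main term `≍ T H² q^{−θ}`
  have hM : nA c * nB ρ * (Real.sqrt 2 * ρ.T q * (1 / (2 * π)) ^ 2) *
      ((2 * H) ^ 2 * (DV * DW * (C * (q : ℝ) ^ (-θ)))) ≤
      cM / 98 * ρ.T q * (q : ℝ) ^ (ε / 4) * (q : ℝ) ^ (-θ) := by
    have : nA c * nB ρ * (Real.sqrt 2 * ρ.T q * (1 / (2 * π)) ^ 2) *
        ((2 * H) ^ 2 * (DV * DW * (C * (q : ℝ) ^ (-θ)))) =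
        cM / 98 * ρ.T q * H ^ 2 * (q : ℝ) ^ (-θ) := by
      rw [hcM]; ring
    rw [this]
    exact mul_le_mul_of_nonneg_right (mul_le_mul_of_nonneg_left hH2 (by positivity)) hqθ
  -- the error term `≍ L³ T H · H^{−(j−1)}`
  have hpow : H ^ (j - 1) = H ^ (j - 2) * H := by
    rw [← pow_succ, show j - 2 + 1 = j - 1 by omega]
  have hr : H / H ^ (j - 1) = 1 / H ^ (j - 2) := by
    rw [hpow, div_mul_eq_div_div_swap, div_self hH0.ne']
  have hEb : DV' / H ^ (j - 1) * (KW * ρ.T q) +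
      1 / (2 * π) * (2 * H) * DV * ρ.T q * (DW' / H ^ (j - 1)) ≤
      (DV' * KW + 1 / (2 * π) * 2 * DV * DW') * ρ.T q * (1 / H ^ (j - 2)) := by
    have h1 : DV' / H ^ (j - 1) * (KW * ρ.T q) ≤ DV' / H ^ (j - 1) * (KW * ρ.T q) * H :=
      le_mul_of_one_le_right (by positivity) hH1
    calc DV' / H ^ (j - 1) * (KW * ρ.T q) +
          1 / (2 * π) * (2 * H) * DV * ρ.T q * (DW' / H ^ (j - 1))
        ≤ DV' / H ^ (j - 1) * (KW * ρ.T q) * H +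
            1 / (2 * π) * (2 * H) * DV * ρ.T q * (DW' / H ^ (j - 1)) := by linarith
      _ = (DV' * KW + 1 / (2 * π) * 2 * DV * DW') * ρ.T q * (H / H ^ (j - 1)) := by ring
      _ = (DV' * KW + 1 / (2 * π) * 2 * DV * DW') * ρ.T q * (1 / H ^ (j - 2)) := by rw [hr]
  have hE : 16 * Real.sqrt 2 * C₀ ^ 4 * lengthL q ^ 3 *
      (2 * GB * Real.sqrt 2 * (DV' / H ^ (j - 1) * (KW * ρ.T q) +
        1 / (2 * π) * (2 * H) * DV * ρ.T q * (DW' / H ^ (j - 1)))) ≤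
      cE / 98 * ρ.T q * (q : ℝ) ^ (ε / 4) * (q : ℝ) ^ (-θ) := by
    calc 16 * Real.sqrt 2 * C₀ ^ 4 * lengthL q ^ 3 *
          (2 * GB * Real.sqrt 2 * (DV' / H ^ (j - 1) * (KW * ρ.T q) +
            1 / (2 * π) * (2 * H) * DV * ρ.T q * (DW' / H ^ (j - 1))))
        ≤ 16 * Real.sqrt 2 * C₀ ^ 4 * lengthL q ^ 3 *
          (2 * GB * Real.sqrt 2 * ((DV' * KW + 1 / (2 * π) * 2 * DV * DW') * ρ.T q *
            (1 / H ^ (j - 2)))) :=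
          mul_le_mul_of_nonneg_left (mul_le_mul_of_nonneg_left hEb (by positivity))
            (by positivity)
      _ = cE / 98 * ρ.T q * (lengthL q ^ 3 * (1 / H ^ (j - 2))) := by rw [hcE]; ring
      _ ≤ cE / 98 * ρ.T q * (q : ℝ) ^ (-θ) := mul_le_mul_of_nonneg_left hL3 (by positivity)
      _ ≤ cE / 98 * ρ.T q * ((q : ℝ) ^ (ε / 4) * (q : ℝ) ^ (-θ)) :=
          mul_le_mul_of_nonneg_left (le_mul_of_one_le_left hqθ hqε4) (by positivity)
      _ = cE / 98 * ρ.T q * (q : ℝ) ^ (ε / 4) * (q : ℝ) ^ (-θ) := by ring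
  have hTot : 2 * ((7 : ℝ) * 7 *
      (nA c * nB ρ * (Real.sqrt 2 * ρ.T q * (1 / (2 * π)) ^ 2) *
          ((2 * H) ^ 2 * (DV * DW * (C * (q : ℝ) ^ (-θ)))) +
        16 * Real.sqrt 2 * C₀ ^ 4 * lengthL q ^ 3 *
          (2 * GB * Real.sqrt 2 * (DV' / H ^ (j - 1) * (KW * ρ.T q) +
            1 / (2 * π) * (2 * H) * DV * ρ.T q * (DW' / H ^ (j - 1)))))) ≤
      (cM + cE) * ρ.T q * (q : ℝ) ^ (ε / 4) * (q : ℝ) ^ (-θ) := by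
    linarith [hM, hE]
  -- conclusion
  calc |offDiagOD c w B ρ χ| ≤ _ := hmain
    _ ≤ (Cn * (q : ℝ) ^ (ε / 2)) * ((cM + cE) * ρ.T q * (q : ℝ) ^ (ε / 4) * (q : ℝ) ^ (-θ)) :=
        mul_le_mul hNB hTot (by positivity) (by positivity)
    _ = Cn * (cM + cE) * ((q : ℝ) ^ (ε / 2) * (q : ℝ) ^ (ε / 4)) * ρ.T q * (q : ℝ) ^ (-θ) := by
        ring
    _ ≤ Cn * (cM + cE) * (q : ℝ) ^ ε * ρ.T q * (q : ℝ) ^ (-θ) := by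
        have h := mul_le_mul_of_nonneg_left hqε (by positivity : (0 : ℝ) ≤ Cn * (cM + cE))
        exact mul_le_mul_of_nonneg_right (mul_le_mul_of_nonneg_right h hT0.le) hqθ
    _ ≤ (Cn * (cM + cE) + 1) * (q : ℝ) ^ ε * ρ.T q * (q : ℝ) ^ (-θ) := by
        have h : Cn * (cM + cE) ≤ Cn * (cM + cE) + 1 := by linarith
        exact mul_le_mul_of_nonneg_right (mul_le_mul_of_nonneg_right
          (mul_le_mul_of_nonneg_right h (by positivity)) hT0.le) hqθ

end Literature.NumberTheory.LFunctions.BondarenkoHeap2026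

end
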